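import Literature.Analysis.FluidPDE.MildSolutionProofs
import Literature.Analysis.FluidPDE.HessianLaplacian
import Literature.Analysis.FluidPDE.SuitableWeak
import Literature.Analysis.UnboundedOperators.HeatFlowCalculus
import HarnessLib

/-!
# Scheffer's localised backward heat kernel test function (Lemarié-Rieusset 2016, §13.9, Step 1)

Analysis/FluidPDE support file in the decomposition of the named fact
`Literature.Analysis.FluidPDE.LemarieRieusset2016.lemma13_4` (`CKNMorreyLemmas.lean`: Lemarié-Rieusset 2016,
Lemma 13.4, Kukavica's Morrey estimates) through Lemma 13.3 (the local energy estimates (13.30)–(13.31),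
p. 470), whose proof (Step 1, pp. 466–470) tests the local energy inequality (13.24) with the test function
chosen by Scheffer (1977):

  `ψ(s, y) = r³ ω((s - t)/ρ², (y - x)/ρ) θ((s - t)/r²) H(4r² + t - s, x - y)`,  `H(t, x) = W_{νt}(x)`,

for `0 < r ≤ ρ/2`, where `ω ∈ 𝒟(ℝ × ℝ³)` is non-negative, supported in `(-1, 1) × B(0, 3/4)` and equal to `1`
on `(-1/4, 1/4) × B(0, 1/2)`, `θ` is smooth, `= 1` on `(-∞, 1)` and `= 0` on `(2, ∞)`, and `W` is the heat
kernel. Everything in this file is **proved**; the main results are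

* `Scheffer.testFn ν r ρ t x : ℝ → E → ℝ` — the function `ψ` on `ℝ × E` for a finite-dimensional real inner
  product space `E` of dimension `n` (prefactor `rⁿ`; `ω(σ, z) = χ(σ) φ(z)` with the bumps
  `Scheffer.timeBump` (`= 1` on `[-1/4, 1/4]`, support `(-1/2, 1/2)`) and `Scheffer.spaceBump` (`= 1` on
  `B̄(0, 1/2)`, support `B(0, 5/8)`), `θ = Scheffer.timeRamp`, `W = UnboundedOperators.heatKernel`);
* `Scheffer.testFn_spec` — the bulleted list of p. 467 with one constant `C = C(ν, n) > 0`: `ψ` is a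
  space–time test function on the cylinder `Q_ρ(t, x) = (t - ρ², t + ρ²) × B(x, ρ)` (accepted
  `Fluid.IsSpaceTimeTestOn (parabolicCylinderCenteredOpens ρ (t, x))`), supported where `|s - t| < ρ²/2` and
  `‖y - x‖ < 5ρ/8 (< 3ρ/4)`; `0 ≤ ψ ≤ C`; `ψ ≥ C⁻¹` on `Q_r(t, x)`; `‖∇_y ψ‖ ≤ C/r`; and
  `|∂_s ψ + ν Δ_y ψ| ≤ C rⁿ/ρⁿ⁺²` for `s < t + r²` — with `∂_s = Fluid.timeDeriv` and `Δ_y` Mathlib's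
  Laplacian of the slice, the operators of the local energy inequality of
  `Fluid.IsSuitableWeakSolutionOn` / `LemarieRieusset2016.IsSuitableOn`;
* `LemarieRieusset2016.exists_scheffer_testFunction` — the printed form in `ℝ × ℝ³` (`r³/ρ⁵`).

## Proof sketch (p. 467)

`K(s, y) = W_{ν(4r²+t-s)}(x - y)` solves the backward heat equation `∂_s K + νΔ_y K = 0` for `s < t + 4r²`
(`Scheffer.deriv_kernel_add_laplacian`, from the closed forms `∂_σ W_σ = ΔW_σ = (‖z‖²/(4σ²) - n/(2σ)) W_σ`,
`Scheffer.laplacian_heatKernel` and the tree's `hasDerivAt_heatKernel_time`). For `s < t + r²` the ramp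
`θ` is `1`, so `(∂_s + νΔ)ψ = rⁿ [ρ⁻² χ' φ_ρ K + ν χ (K Δφ_ρ + 2 ∇φ_ρ · ∇K)]`: the derivatives of the cut-off
live off `Q_{ρ/2}(t, x)` — `χ' ≠ 0` forces `t - s ≥ ρ²/4`, hence `K ≤ (πνρ²)^{-n/2}`; `∇φ_ρ, Δφ_ρ ≠ 0` force
`ρ/2 ≤ ‖x - y‖`, where the off-diagonal Gaussian bounds `W_σ(z) ≤ C ‖z‖⁻ⁿ`, `‖∇W_σ(z)‖ ≤ C ‖z‖⁻ⁿ⁻¹`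
(`Scheffer.exists_heatKernel_le_div_pow`, `Scheffer.exists_norm_fderiv_heatKernel_le_div_pow`, from
`a⁻ᵏ e^{-c/a} ≤ (k/c)ᵏ`) apply — which gives `C rⁿ ρ⁻ⁿ⁻²`. On the support of `θ((s-t)/r²)` one has
`σ = ν(4r² + t - s) ≥ 2νr²`, whence `K ≤ (8πν r²)^{-n/2}` (`ψ ≤ C`) and `‖∇K‖ ≤ C r⁻ⁿ⁻¹` (`‖∇ψ‖ ≤ C/r`,
using `ρ ≥ 2r` for the cut-off gradient); on `Q_r(t, x)` all cut-offs are `1`, `σ ∈ (3νr², 5νr²)` and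
`‖x - y‖ < r`, whence `ψ ≥ (20πν)^{-n/2} e^{-1/(12ν)}`. Smoothness across the singular time `s = t + 4r²`
of `K` holds because `θ` vanishes for `s ≥ t + 2r²`.

## Design notes

* Constants are existential (`∃ C`) but depend on `ν` and `n` only, as the proof of Lemma 13.3 requires
  ("`C` means some positive constant which depends on `ν`", p. 467).
* The support statement is given in the sharper form `|s - t| < ρ²/2`, `‖y - x‖ < 5ρ/8`, which implies the
  printed `(t - ρ², t + ρ²) × B(x, 3ρ/4)` (used on p. 467 for the pressure term, where `ζ p = p` on
  `B(x, 3ρ/4)`).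
* The bound on `(∂_s + νΔ_y)ψ` is proved for all `y` (not only on `Q_ρ(t, x)`; off the support both sides
  are trivially compatible) and all `s < t + r²`, the range needed when (13.24) is applied with
  `τ ≤ t + r²`.

## What is NOT here

The consequences (13.25)–(13.29) of testing the local energy inequality with `ψ` (they need the
integrated form (13.24) of the local energy inequality, Sobolev/interpolation inequalities on balls and
the pressure decomposition), i.e. Lemma 13.3 itself.

## References

* P. G. Lemarié-Rieusset, *The Navier–Stokes Problem in the 21st Century*, CRC Press (2016), §13.9,
  Step 1, p. 467 (the test function `ψ` and its properties). [LemarieRieusset2016]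
* V. Scheffer, *Hausdorff measure and the Navier–Stokes equations*, Comm. Math. Phys. 55 (1977),
  97–112 (the original choice of `ψ`, [426] in Lemarié-Rieusset). [Scheffer1977]
* L. C. Evans, *Partial Differential Equations*, 2nd ed. (2010), §2.3.1 (the heat kernel).
-/

noncomputable section

open MeasureTheory Filter Topology Set InnerProductSpace Metric Function
open scoped Real NNReal RealInnerProductSpace Laplacian ContDiff

namespace Literature.Analysis.FluidPDE

namespace Scheffer

open UnboundedOperators

/-! ### Elementary Gaussian bounds -/

/-- The optimisation behind every off-diagonal Gaussian bound:
`a^{-k} e^{-c/a} ≤ (k/c)^k` for `k ≥ 0`, `c > 0`, `a > 0` (the maximum of `u ↦ u^k e^{-u}` is at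
most `k^k`). [folklore] -/
theorem rpow_neg_mul_exp_neg_div_le {k c a : ℝ} (hk : 0 ≤ k) (hc : 0 < c) (ha : 0 < a) :
    a ^ (-k) * Real.exp (-c / a) ≤ (k / c) ^ k := by
  rcases hk.eq_or_lt with rfl | hk0
  · simp only [neg_zero, Real.rpow_zero, one_mul, zero_div]
    exact Real.exp_le_one_iff.2 (div_nonpos_of_nonpos_of_nonneg (neg_nonpos.2 hc.le) ha.le)
  set u : ℝ := c / a with hu_def
  have hu : 0 < u := div_pos hc ha
  -- `u^k ≤ k^k e^u`
  have h1 : u / k ≤ Real.exp (u / k - 1) := by linarith [Real.add_one_le_exp (u / k - 1)]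
  have h2 : (u / k) ^ k ≤ Real.exp u := by
    calc (u / k) ^ k ≤ (Real.exp (u / k - 1)) ^ k := Real.rpow_le_rpow (by positivity) h1 hk
      _ = Real.exp (u - k) := by
          rw [← Real.exp_mul]
          congr 1
          field_simp
      _ ≤ Real.exp u := Real.exp_le_exp.2 (by linarith)
  have h3 : u ^ k ≤ k ^ k * Real.exp u := by
    have : u ^ k = k ^ k * (u / k) ^ k := by
      rw [Real.div_rpow hu.le hk0.le, mul_div_cancel₀ _ (Real.rpow_pos_of_pos hk0 k).ne']
    rw [this]
    exact mul_le_mul_of_nonneg_left h2 (Real.rpow_nonneg hk0.le k)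
  -- `a^{-k} = c^{-k} u^k` and `e^{-c/a} = (e^u)⁻¹`
  have h4 : a ^ (-k) = (c ^ k)⁻¹ * u ^ k := by
    rw [hu_def, Real.div_rpow hc.le ha.le, Real.rpow_neg ha.le]
    field_simp
  have h5 : Real.exp (-c / a) = (Real.exp u)⁻¹ := by
    rw [← Real.exp_neg, hu_def, neg_div]
  rw [h4, h5, Real.div_rpow hk0.le hc.le]
  have hck : 0 < c ^ k := Real.rpow_pos_of_pos hc k
  have heu : 0 < Real.exp u := Real.exp_pos u
  rw [div_eq_mul_inv, mul_comm (k ^ k)]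
  rw [mul_assoc]
  refine mul_le_mul_of_nonneg_left ?_ (inv_nonneg.2 hck.le)
  rw [mul_inv_le_iff₀ heu]
  exact h3

/-! ### The one-dimensional cut-offs `θ` (time ramp) and `χ` (time bump) -/

/-- The time ramp `θ(σ) = smoothTransition (2 - σ)`: smooth, `= 1` for `σ ≤ 1`, `= 0` for `σ ≥ 2`,
values in `[0, 1]` (the factor `θ((s - t)/r²)` of Lemarié-Rieusset 2016, p. 467). [folklore] -/
def timeRamp (σ : ℝ) : ℝ := Real.smoothTransition (2 - σ)

/-- `θ(σ) = 1` for `σ ≤ 1`. [folklore] -/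
theorem timeRamp_of_le_one {σ : ℝ} (h : σ ≤ 1) : timeRamp σ = 1 :=
  Real.smoothTransition.one_of_one_le (by linarith)

/-- `θ(σ) = 0` for `σ ≥ 2`. [folklore] -/
theorem timeRamp_of_two_le {σ : ℝ} (h : 2 ≤ σ) : timeRamp σ = 0 :=
  Real.smoothTransition.zero_of_nonpos (by linarith)

/-- `θ ≥ 0`. [folklore] -/
theorem timeRamp_nonneg (σ : ℝ) : 0 ≤ timeRamp σ := Real.smoothTransition.nonneg _

/-- `θ ≤ 1`. [folklore] -/
theorem timeRamp_le_one (σ : ℝ) : timeRamp σ ≤ 1 := Real.smoothTransition.le_one _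

/-- `θ` is smooth. [folklore] -/
theorem contDiff_timeRamp {m : ℕ∞} : ContDiff ℝ m timeRamp :=
  Real.smoothTransition.contDiff.comp (contDiff_const.sub contDiff_id)

/-- The time cut-off `χ`: a smooth bump on `ℝ` equal to `1` on `[-1/4, 1/4]` and supported in
`(-1/2, 1/2)` (the time factor of Scheffer's `ω`, Lemarié-Rieusset 2016, p. 467). [folklore] -/
def timeBump : ContDiffBump (0 : ℝ) := ⟨1 / 4, 1 / 2, by norm_num, by norm_num⟩

/-- A bound for the derivative of the time cut-off. [folklore] -/
theorem exists_abs_deriv_timeBump_le : ∃ M : ℝ, 0 ≤ M ∧ ∀ σ, |deriv (⇑timeBump) σ| ≤ M := by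
  have hc : Continuous (deriv (⇑timeBump)) :=
    (timeBump.contDiff (n := 1)).continuous_deriv le_rfl
  obtain ⟨M, hM⟩ := hc.bounded_above_of_compact_support timeBump.hasCompactSupport.deriv
  exact ⟨max M 0, le_max_right _ _, fun σ => (Real.norm_eq_abs _ ▸ hM σ).trans (le_max_left _ _)⟩

/-- The derivative of the time cut-off vanishes where the cut-off is `1`; contrapositive form:
`χ'(σ) ≠ 0` forces `1/4 ≤ |σ|`. [folklore] -/
theorem abs_ge_of_deriv_timeBump_ne_zero {σ : ℝ} (h : deriv (⇑timeBump) σ ≠ 0) : 1 / 4 ≤ |σ| := by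
  refine le_of_not_gt fun hσ => h ?_
  have h1 : (⇑timeBump) =ᶠ[𝓝 σ] fun _ => (1 : ℝ) :=
    timeBump.eventuallyEq_one_of_mem_ball (by simpa [timeBump] using hσ)
  rw [h1.deriv_eq]
  simp

/-- `χ(σ) ≠ 0` forces `|σ| < 1/2`. [folklore] -/
theorem abs_lt_of_timeBump_ne_zero {σ : ℝ} (h : timeBump σ ≠ 0) : |σ| < 1 / 2 := by
  have : σ ∈ Function.support (⇑timeBump) := h
  rw [timeBump.support_eq] at this
  simpa [timeBump] using this

/-- `χ(σ) = 1` for `|σ| ≤ 1/4`. [folklore] -/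
theorem timeBump_eq_one {σ : ℝ} (h : |σ| ≤ 1 / 4) : timeBump σ = 1 :=
  timeBump.one_of_mem_closedBall (by simpa [timeBump] using h)

variable {E : Type*} [NormedAddCommGroup E] [InnerProductSpace ℝ E]

/-! ### Bounds for the heat kernel and its gradient -/

/-- `(d²)^{-m/2} = (d^m)⁻¹` for `d ≥ 0` and a natural number `m`. [folklore] -/
theorem sq_rpow_neg_half (m : ℕ) {d : ℝ} (hd : 0 ≤ d) :
    (d ^ 2) ^ (-(m : ℝ) / 2) = (d ^ m)⁻¹ := by
  rw [show d ^ 2 = d ^ (2 : ℝ) by norm_cast, ← Real.rpow_mul hd,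
    show (2 : ℝ) * (-(m : ℝ) / 2) = -(m : ℝ) by ring, Real.rpow_neg hd, Real.rpow_natCast]

/-- `(a d²)^{-m/2} = a^{-m/2} (d^m)⁻¹` for `a, d ≥ 0`. [folklore] -/
theorem mul_sq_rpow_neg_half (m : ℕ) {a d : ℝ} (ha : 0 ≤ a) (hd : 0 ≤ d) :
    (a * d ^ 2) ^ (-(m : ℝ) / 2) = a ^ (-(m : ℝ) / 2) * (d ^ m)⁻¹ := by
  rw [Real.mul_rpow ha (by positivity), sq_rpow_neg_half m hd]

/-- The heat kernel is smooth in space (for every fixed time, junk times included). Twin of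
`KochTataruPairing.contDiff_heatKernel_space` / `GaussianSchwartz.contDiff_heatKernel'` /
`BMOCarlesonProofs.contDiff_heatKernel`, not imported here (their import closures are foreign to
this file); recorded for the librarian. [folklore] -/
theorem contDiff_heatKernel {m : WithTop ℕ∞} (σ : ℝ) : ContDiff ℝ m (heatKernel (E := E) σ) := by
  unfold heatKernel
  exact contDiff_const.mul (Real.contDiff_exp.comp ((contDiff_norm_sq ℝ).neg.div_const _))

/-- Peak bound, monotone in time: `G_σ(z) ≤ (4πσ₀)^{-n/2}` for `0 < σ₀ ≤ σ`. [folklore] -/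
theorem heatKernel_le_peak {σ₀ σ : ℝ} (h0 : 0 < σ₀) (h : σ₀ ≤ σ) (z : E) :
    heatKernel σ z ≤ (4 * π * σ₀) ^ (-(Module.finrank ℝ E : ℝ) / 2) := by
  refine (heatKernel_le (h0.trans_le h) z).trans ?_
  refine Real.rpow_le_rpow_of_nonpos (by positivity) (by nlinarith [Real.pi_pos]) ?_
  have : (0 : ℝ) ≤ Module.finrank ℝ E := Nat.cast_nonneg _
  linarith [div_nonneg this zero_le_two]

/-- **Off-diagonal bound for the heat kernel**: there is `C = C(n) ≥ 0` with
`G_σ(z) ≤ C / d^n` whenever `0 < σ`, `0 < d ≤ ‖z‖` (`n = dim E`; from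
`σ^{-n/2} e^{-d²/(4σ)} ≤ (2n/d²)^{n/2}`). [folklore] -/
theorem exists_heatKernel_le_div_pow :
    ∃ C : ℝ, 0 ≤ C ∧ ∀ (σ d : ℝ) (z : E), 0 < σ → 0 < d → d ≤ ‖z‖ →
      heatKernel σ z ≤ C / d ^ Module.finrank ℝ E := by
  set n : ℕ := Module.finrank ℝ E with hn
  set k : ℝ := (n : ℝ) / 2 with hk
  have hk0 : 0 ≤ k := by positivity
  refine ⟨(4 * π) ^ (-(n : ℝ) / 2) * (4 * k) ^ k, by positivity, fun σ d z hσ hd hdz => ?_⟩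
  have h4π : (0 : ℝ) ≤ 4 * π := by positivity
  -- `G_σ(z) ≤ (4πσ)^{-n/2} e^{-d²/(4σ)}`
  have h1 : heatKernel σ z ≤ (4 * π * σ) ^ (-(n : ℝ) / 2) * Real.exp (-(d ^ 2 / 4) / σ) := by
    rw [hn, heatKernel]
    refine mul_le_mul_of_nonneg_left (Real.exp_le_exp.2 ?_) (by positivity)
    rw [neg_div, neg_div, neg_le_neg_iff, div_div, div_le_div_iff_of_pos_right (by positivity)]
    exact pow_le_pow_left₀ hd.le hdz 2
  -- optimise in `σ`
  have h2 : σ ^ (-k) * Real.exp (-(d ^ 2 / 4) / σ) ≤ (k / (d ^ 2 / 4)) ^ k :=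
    rpow_neg_mul_exp_neg_div_le hk0 (by positivity) hσ
  have h3 : (k / (d ^ 2 / 4)) ^ k = (4 * k) ^ k * (d ^ n)⁻¹ := by
    rw [show k / (d ^ 2 / 4) = (4 * k) * (d ^ 2)⁻¹ by field_simp, Real.mul_rpow (by positivity)
      (by positivity), Real.inv_rpow (by positivity), ← Real.rpow_neg (by positivity),
      show -k = -(n : ℝ) / 2 by rw [hk]; ring, sq_rpow_neg_half n hd.le]
  calc heatKernel σ z ≤ (4 * π * σ) ^ (-(n : ℝ) / 2) * Real.exp (-(d ^ 2 / 4) / σ) := h1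
    _ = (4 * π) ^ (-(n : ℝ) / 2) * (σ ^ (-k) * Real.exp (-(d ^ 2 / 4) / σ)) := by
        rw [Real.mul_rpow h4π hσ.le, hk, neg_div, mul_assoc]
    _ ≤ (4 * π) ^ (-(n : ℝ) / 2) * (k / (d ^ 2 / 4)) ^ k :=
        mul_le_mul_of_nonneg_left h2 (by positivity)
    _ = (4 * π) ^ (-(n : ℝ) / 2) * (4 * k) ^ k / d ^ n := by
        rw [h3]; ring

/-- Peak bound for the gradient, monotone in time:
`‖∇G_σ(z)‖ ≤ (4πσ₀)^{-n/2} (√σ₀)⁻¹` for `0 < σ₀ ≤ σ`. [folklore] -/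
theorem norm_fderiv_heatKernel_le_peak {σ₀ σ : ℝ} (h0 : 0 < σ₀) (h : σ₀ ≤ σ) (z : E) :
    ‖fderiv ℝ (heatKernel σ) z‖ ≤
      (4 * π * σ₀) ^ (-(Module.finrank ℝ E : ℝ) / 2) * (Real.sqrt σ₀)⁻¹ := by
  have hσ : 0 < σ := h0.trans_le h
  refine (norm_fderiv_heatKernel_le hσ z).trans ?_
  have hexp : Real.exp (-(1 / (8 * σ)) * ‖z‖ ^ 2) ≤ 1 :=
    Real.exp_le_one_iff.2 (by nlinarith [sq_nonneg ‖z‖, one_div_pos.2 (by positivity : (0:ℝ) < 8 * σ)])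
  have hn0 : -(Module.finrank ℝ E : ℝ) / 2 ≤ 0 := by
    have : (0 : ℝ) ≤ Module.finrank ℝ E := Nat.cast_nonneg _
    linarith [div_nonneg this zero_le_two]
  calc (4 * π * σ) ^ (-(Module.finrank ℝ E : ℝ) / 2) * (Real.sqrt σ)⁻¹ *
        Real.exp (-(1 / (8 * σ)) * ‖z‖ ^ 2)
      ≤ (4 * π * σ) ^ (-(Module.finrank ℝ E : ℝ) / 2) * (Real.sqrt σ)⁻¹ * 1 := by
        gcongr
    _ ≤ (4 * π * σ₀) ^ (-(Module.finrank ℝ E : ℝ) / 2) * (Real.sqrt σ₀)⁻¹ := by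
        rw [mul_one]
        refine mul_le_mul ?_ ?_ (by positivity) (by positivity)
        · exact Real.rpow_le_rpow_of_nonpos (by positivity) (by nlinarith [Real.pi_pos]) hn0
        · exact inv_anti₀ (Real.sqrt_pos.2 h0) (Real.sqrt_le_sqrt h)

/-- **Off-diagonal bound for the gradient of the heat kernel**: there is `C = C(n) ≥ 0` with
`‖∇G_σ(z)‖ ≤ C / d^{n+1}` whenever `0 < σ`, `0 < d ≤ ‖z‖`. [folklore] -/
theorem exists_norm_fderiv_heatKernel_le_div_pow :
    ∃ C : ℝ, 0 ≤ C ∧ ∀ (σ d : ℝ) (z : E), 0 < σ → 0 < d → d ≤ ‖z‖ →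
      ‖fderiv ℝ (heatKernel σ) z‖ ≤ C / d ^ (Module.finrank ℝ E + 1) := by
  set n : ℕ := Module.finrank ℝ E with hn
  set k : ℝ := ((n + 1 : ℕ) : ℝ) / 2 with hk
  have hk0 : 0 ≤ k := by positivity
  refine ⟨(4 * π) ^ (-(n : ℝ) / 2) * (8 * k) ^ k, by positivity, fun σ d z hσ hd hdz => ?_⟩
  have h4π : (0 : ℝ) ≤ 4 * π := by positivity
  have h1 : ‖fderiv ℝ (heatKernel σ) z‖ ≤
      (4 * π * σ) ^ (-(n : ℝ) / 2) * (Real.sqrt σ)⁻¹ * Real.exp (-(d ^ 2 / 8) / σ) := by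
    refine (norm_fderiv_heatKernel_le hσ z).trans ?_
    refine mul_le_mul_of_nonneg_left (Real.exp_le_exp.2 ?_) (by positivity)
    rw [neg_div, neg_mul, neg_le_neg_iff, div_div, one_div_mul_eq_div,
      div_le_div_iff_of_pos_right (by positivity)]
    exact pow_le_pow_left₀ hd.le hdz 2
  -- `(4πσ)^{-n/2} (√σ)⁻¹ = (4π)^{-n/2} σ^{-k}`
  have h2 : (4 * π * σ) ^ (-(n : ℝ) / 2) * (Real.sqrt σ)⁻¹ = (4 * π) ^ (-(n : ℝ) / 2) * σ ^ (-k) := by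
    rw [Real.mul_rpow h4π hσ.le, Real.sqrt_eq_rpow, ← Real.rpow_neg hσ.le, mul_assoc,
      ← Real.rpow_add hσ, hk]
    congr 2
    push_cast
    ring
  have h3 : σ ^ (-k) * Real.exp (-(d ^ 2 / 8) / σ) ≤ (k / (d ^ 2 / 8)) ^ k :=
    rpow_neg_mul_exp_neg_div_le hk0 (by positivity) hσ
  have h4 : (k / (d ^ 2 / 8)) ^ k = (8 * k) ^ k * (d ^ (n + 1))⁻¹ := by
    rw [show k / (d ^ 2 / 8) = (8 * k) * (d ^ 2)⁻¹ by field_simp, Real.mul_rpow (by positivity)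
      (by positivity), Real.inv_rpow (by positivity), ← Real.rpow_neg (by positivity),
      show -k = -((n + 1 : ℕ) : ℝ) / 2 by rw [hk]; ring, sq_rpow_neg_half (n + 1) hd.le]
  calc ‖fderiv ℝ (heatKernel σ) z‖
      ≤ (4 * π * σ) ^ (-(n : ℝ) / 2) * (Real.sqrt σ)⁻¹ * Real.exp (-(d ^ 2 / 8) / σ) := h1
    _ = (4 * π) ^ (-(n : ℝ) / 2) * (σ ^ (-k) * Real.exp (-(d ^ 2 / 8) / σ)) := by
        rw [h2, mul_assoc]
    _ ≤ (4 * π) ^ (-(n : ℝ) / 2) * (k / (d ^ 2 / 8)) ^ k :=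
        mul_le_mul_of_nonneg_left h3 (by positivity)
    _ = (4 * π) ^ (-(n : ℝ) / 2) * (8 * k) ^ k / d ^ (n + 1) := by
        rw [h4]; ring

/-! ### Second derivatives of the heat kernel -/

/-- The pure second directional derivatives of the heat kernel:
`∂ᵥ∂ᵥ G_σ(z) = G_σ(z) (⟪z, v⟫²/(4σ²) - ‖v‖²/(2σ))` (all real `σ`, junk conventions included). [folklore] -/
theorem fderiv_fderiv_heatKernel_apply_self (σ : ℝ) (z v : E) :
    fderiv ℝ (fun w => fderiv ℝ (heatKernel σ) w v) z v =
      heatKernel σ z * (⟪z, v⟫ ^ 2 / (4 * σ ^ 2) - ‖v‖ ^ 2 / (2 * σ)) := by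
  have hfun : (fun w => fderiv ℝ (heatKernel σ) w v) =
      fun w => (-(heatKernel σ w / (2 * σ))) * ⟪w, v⟫ :=
    funext fun w => fderiv_heatKernel_apply_eq_mul_inner σ w v
  rw [hfun]
  have hG := hasFDerivAt_heatKernel σ z
  have ha : HasFDerivAt (fun w => -(heatKernel σ w / (2 * σ)))
      ((-(1 / (2 * σ))) • ((-(heatKernel σ z / (2 * σ))) • innerSL ℝ z)) z := by
    refine (hG.const_mul (-(1 / (2 * σ)))).congr_of_eventuallyEq
      (Eventually.of_forall fun w => ?_)
    simp only
    ring
  have hb : HasFDerivAt (fun w : E => ⟪w, v⟫) (innerSL ℝ v) z := by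
    refine ((innerSL ℝ v).hasFDerivAt).congr_of_eventuallyEq (Eventually.of_forall fun w => ?_)
    simp only [innerSL_apply_apply, real_inner_comm]
  rw [(ha.fun_mul hb).fderiv]
  simp only [_root_.add_apply, _root_.FunLike.coe_smul, Pi.smul_apply,
    innerSL_apply_apply, smul_eq_mul, real_inner_self_eq_norm_sq]
  ring

/-! ### Scheffer's backward kernel `K` (no finite-dimensionality needed) -/

/-- Scheffer's backward heat kernel factor `K(s, y) = W_{ν(4r² + t - s)}(x - y)`
(Lemarié-Rieusset 2016, p. 467: `H(4r² + t - s, x - y)` with `H(t, x) = W_{νt}(x)`), in terms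
of the accepted `heatKernel`. [cite: LemarieRieusset2016, §13.9 Step 1 p. 467] -/
def kernel (ν r t : ℝ) (x : E) (s : ℝ) (y : E) : ℝ :=
  heatKernel (ν * (4 * r ^ 2 + t - s)) (x - y)

/-- Unfolding `kernel`. [folklore] -/
theorem kernel_apply (ν r t : ℝ) (x : E) (s : ℝ) (y : E) :
    kernel ν r t x s y = heatKernel (ν * (4 * r ^ 2 + t - s)) (x - y) := rfl

/-- The time derivative of `K` below the singular time `t + 4r²`:
`∂_s K(s, y) = -ν (∂_σ G)_{σ = ν(4r²+t-s)}(x - y)`. [folklore] -/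
theorem hasDerivAt_kernel {ν r t s : ℝ} (hσ : 0 < ν * (4 * r ^ 2 + t - s)) (x y : E) :
    HasDerivAt (fun s' => kernel ν r t x s' y)
      ((‖x - y‖ ^ 2 / (4 * (ν * (4 * r ^ 2 + t - s)) ^ 2) -
        (Module.finrank ℝ E : ℝ) / (2 * (ν * (4 * r ^ 2 + t - s)))) *
        heatKernel (ν * (4 * r ^ 2 + t - s)) (x - y) * (-ν)) s := by
  have h1 := hasDerivAt_heatKernel_time hσ (x - y)
  have h2 : HasDerivAt (fun s' => ν * (4 * r ^ 2 + t - s')) (-ν) s := by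
    simpa using ((hasDerivAt_id s).const_sub (4 * r ^ 2 + t)).const_mul ν
  exact h1.comp s h2

/-- Joint smoothness of `K` below the singular time: `(s, y) ↦ K(s, y)` is `C^∞` on
`{s < t + 4r²} × E` (for `ν > 0`). [folklore] -/
theorem contDiffOn_uncurry_kernel {ν : ℝ} (hν : 0 < ν) (r t : ℝ) (x : E) {m : WithTop ℕ∞} :
    ContDiffOn ℝ m (fun q : ℝ × E => kernel ν r t x q.1 q.2) (Iio (t + 4 * r ^ 2) ×ˢ univ) := by
  have hmap : ContDiff ℝ m (fun q : ℝ × E => ((ν * (4 * r ^ 2 + t - q.1), x - q.2) : ℝ × E)) := by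
    fun_prop
  have hmaps : MapsTo (fun q : ℝ × E => ((ν * (4 * r ^ 2 + t - q.1), x - q.2) : ℝ × E))
      (Iio (t + 4 * r ^ 2) ×ˢ univ) (Ioi 0 ×ˢ univ) := by
    intro q hq
    refine ⟨mul_pos hν ?_, mem_univ _⟩
    have := (mem_prod.1 hq).1
    simp only [mem_Iio] at this
    linarith
  exact (contDiffOn_uncurry_heatKernel (m := m)).comp hmap.contDiffOn hmaps

/-- `K ≥ 0` below the singular time. [folklore] -/
theorem kernel_nonneg {ν r t s : ℝ} (hσ : 0 < ν * (4 * r ^ 2 + t - s)) (x y : E) :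
    0 ≤ kernel ν r t x s y := (heatKernel_pos hσ _).le

/-- `‖ρ⁻¹ w‖ = ‖w‖/ρ` for `ρ > 0`. [folklore] -/
theorem norm_inv_smul_eq {ρ : ℝ} (hρ : 0 < ρ) (w : E) : ‖ρ⁻¹ • w‖ = ‖w‖ / ρ := by
  rw [norm_smul, norm_inv, Real.norm_of_nonneg hρ.le, div_eq_inv_mul]

/-- Reflected argument: `‖D(Φ(x - ·))(y)‖ = ‖DΦ(x - y)‖`. [folklore] -/
theorem norm_fderiv_comp_sub_left {Φ : E → ℝ} (hΦ : ContDiff ℝ 1 Φ) (x y : E) :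
    ‖fderiv ℝ (fun z => Φ (x - z)) y‖ = ‖fderiv ℝ Φ (x - y)‖ := by
  have : fderiv ℝ (fun z => Φ (x - z)) y = -fderiv ℝ Φ (x - y) := by
    ext v
    rw [FunctionSpaces.fderiv_comp_sub_left_apply hΦ x y v]
    rfl
  rw [this, norm_neg]

/-! ### The Laplacian of the heat kernel and the caloric identity for `K` -/

variable [FiniteDimensional ℝ E]

/-- **The Laplacian of the heat kernel**: `ΔG_σ(z) = (‖z‖²/(4σ²) - n/(2σ)) G_σ(z)`, which is
`∂_σ G_σ(z)` (`hasDerivAt_heatKernel_time`): the heat equation for the kernel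
(Evans, *PDE*, §2.3.1). [folklore] -/
theorem laplacian_heatKernel (σ : ℝ) (z : E) :
    (Δ (heatKernel (E := E) σ)) z =
      (‖z‖ ^ 2 / (4 * σ ^ 2) - (Module.finrank ℝ E : ℝ) / (2 * σ)) * heatKernel σ z := by
  set b := stdOrthonormalBasis ℝ E with hb
  rw [laplacian_eq_sum_fderiv_fderiv b (contDiff_heatKernel σ) z]
  simp_rw [fderiv_fderiv_heatKernel_apply_self]
  have h1 : ∀ i, ‖b i‖ = 1 := fun i => b.orthonormal.1 i
  have h2 : ∑ i, ⟪z, b i⟫ ^ 2 = ‖z‖ ^ 2 := by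
    rw [← real_inner_self_eq_norm_sq, ← b.sum_inner_mul_inner z z]
    exact Finset.sum_congr rfl fun i _ => by rw [sq, real_inner_comm (b i) z]
  simp_rw [h1, one_pow]
  rw [← Finset.mul_sum, Finset.sum_sub_distrib, ← Finset.sum_div, h2, Finset.sum_const,
    Finset.card_univ, Fintype.card_fin, nsmul_eq_mul, mul_comm]
  ring

/-- The spatial Laplacian of `K`: `Δ_y K(s, ·)(y) = (ΔG_σ)(x - y)`, `σ = ν(4r² + t - s)`. [folklore] -/
theorem laplacian_kernel (ν r t : ℝ) (x : E) (s : ℝ) (y : E) :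
    (Δ (kernel ν r t x s)) y =
      (‖x - y‖ ^ 2 / (4 * (ν * (4 * r ^ 2 + t - s)) ^ 2) -
        (Module.finrank ℝ E : ℝ) / (2 * (ν * (4 * r ^ 2 + t - s)))) *
        heatKernel (ν * (4 * r ^ 2 + t - s)) (x - y) := by
  rw [show kernel ν r t x s = fun y => heatKernel (ν * (4 * r ^ 2 + t - s)) (x - y) from rfl,
    laplacian_comp_sub_left (contDiff_heatKernel _) x y, laplacian_heatKernel]

/-- **`K` solves the backward heat equation** `∂_s K + ν Δ_y K = 0` for `s < t + 4r²`
(Lemarié-Rieusset 2016, p. 467: "`(∂_s + νΔ_y)(H(4r² + t - s, x - y)) = 0`"). [cite: LemarieRieusset2016, §13.9 Step 1 p. 467] -/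
theorem deriv_kernel_add_laplacian {ν r t s : ℝ} (hσ : 0 < ν * (4 * r ^ 2 + t - s)) (x y : E) :
    deriv (fun s' => kernel ν r t x s' y) s + ν * (Δ (kernel ν r t x s)) y = 0 := by
  rw [(hasDerivAt_kernel hσ x y).deriv, laplacian_kernel]
  ring

/-! ### The space cut-off `φ` -/

/-- The Laplacian of a constant vanishes. [folklore] -/
theorem laplacian_const (c : ℝ) (w : E) : (Δ (fun _ : E => c)) w = 0 := by
  rw [laplacian_eq_sum_fderiv_fderiv (stdOrthonormalBasis ℝ E) contDiff_const w]
  simp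

/-- The space cut-off `φ`: a smooth bump on `E` equal to `1` on `B̄(0, 1/2)` and supported in
`B(0, 5/8) ⊆ B(0, 3/4)` (the space factor of Scheffer's `ω`, Lemarié-Rieusset 2016, p. 467). [folklore] -/
def spaceBump : ContDiffBump (0 : E) := ⟨1 / 2, 5 / 8, by norm_num, by norm_num⟩

/-- A bound for the gradient of the space cut-off. [folklore] -/
theorem exists_norm_fderiv_spaceBump_le :
    ∃ M : ℝ, 0 ≤ M ∧ ∀ w : E, ‖fderiv ℝ (⇑(spaceBump (E := E))) w‖ ≤ M := by
  have hc : Continuous (fderiv ℝ (⇑(spaceBump (E := E)))) :=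
    (spaceBump.contDiff (n := 1)).continuous_fderiv one_ne_zero
  obtain ⟨M, hM⟩ := hc.bounded_above_of_compact_support (spaceBump.hasCompactSupport.fderiv (𝕜 := ℝ))
  exact ⟨max M 0, le_max_right _ _, fun w => (hM w).trans (le_max_left _ _)⟩

/-- A bound for the Laplacian of the space cut-off. [folklore] -/
theorem exists_abs_laplacian_spaceBump_le :
    ∃ M : ℝ, 0 ≤ M ∧ ∀ w : E, |(Δ (⇑(spaceBump (E := E)))) w| ≤ M := by
  have h2 : ContDiff ℝ 2 (⇑(spaceBump (E := E))) := spaceBump.contDiff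
  have hcs : HasCompactSupport (Δ (⇑(spaceBump (E := E)))) :=
    HasCompactSupport.intro spaceBump.hasCompactSupport fun x hx =>
      laplacian_eq_zero_of_notMem_tsupport hx
  obtain ⟨M, hM⟩ := (continuous_laplacian h2).bounded_above_of_compact_support hcs
  exact ⟨max M 0, le_max_right _ _, fun w => (Real.norm_eq_abs _ ▸ hM w).trans (le_max_left _ _)⟩

/-! ### The scaled space cut-off `φ_ρ(w) = φ(w/ρ)` -/

/-- The scaled space cut-off `φ_ρ(w) = φ(ρ⁻¹ w)`: `= 1` on `‖w‖ ≤ ρ/2`, `= 0` on `‖w‖ ≥ 5ρ/8`. [folklore] -/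
def spaceCut (ρ : ℝ) (w : E) : ℝ := spaceBump (E := E) (ρ⁻¹ • w)

/-- Unfolding `spaceCut`. [folklore] -/
theorem spaceCut_def (ρ : ℝ) : spaceCut (E := E) ρ = fun w => (⇑(spaceBump (E := E))) (ρ⁻¹ • w) :=
  rfl

/-- `φ_ρ` is smooth. [folklore] -/
theorem contDiff_spaceCut {m : ℕ∞} (ρ : ℝ) : ContDiff ℝ m (spaceCut (E := E) ρ) :=
  spaceBump.contDiff.comp (contDiff_const_smul _)

/-- `φ_ρ ≥ 0`. [folklore] -/
theorem spaceCut_nonneg (ρ : ℝ) (w : E) : 0 ≤ spaceCut ρ w := spaceBump.nonneg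

/-- `φ_ρ ≤ 1`. [folklore] -/
theorem spaceCut_le_one (ρ : ℝ) (w : E) : spaceCut ρ w ≤ 1 := spaceBump.le_one

/-- `φ_ρ = 1` on `‖w‖ ≤ ρ/2`. [folklore] -/
theorem spaceCut_eq_one {ρ : ℝ} (hρ : 0 < ρ) {w : E} (hw : ‖w‖ ≤ ρ / 2) : spaceCut ρ w = 1 := by
  refine spaceBump.one_of_mem_closedBall ?_
  rw [mem_closedBall, dist_zero_right, norm_inv_smul_eq hρ]
  change ‖w‖ / ρ ≤ 1 / 2
  rw [div_le_iff₀ hρ]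
  linarith

/-- `φ_ρ = 0` on `‖w‖ ≥ 5ρ/8`. [folklore] -/
theorem spaceCut_eq_zero {ρ : ℝ} (hρ : 0 < ρ) {w : E} (hw : 5 * ρ / 8 ≤ ‖w‖) : spaceCut ρ w = 0 := by
  refine spaceBump.zero_of_le_dist ?_
  rw [dist_zero_right, norm_inv_smul_eq hρ]
  change 5 / 8 ≤ ‖w‖ / ρ
  rw [le_div_iff₀ hρ]
  linarith

/-- `φ_ρ(w) ≠ 0` forces `‖w‖ < 5ρ/8`. [folklore] -/
theorem norm_lt_of_spaceCut_ne_zero {ρ : ℝ} (hρ : 0 < ρ) {w : E} (hw : spaceCut ρ w ≠ 0) :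
    ‖w‖ < 5 * ρ / 8 :=
  lt_of_not_ge fun h => hw (spaceCut_eq_zero hρ h)

/-- Near a point with `‖w‖ < ρ/2`, `φ_ρ` is the constant `1`. [folklore] -/
theorem spaceCut_eventuallyEq_one {ρ : ℝ} (hρ : 0 < ρ) {w : E} (hw : ‖w‖ < ρ / 2) :
    spaceCut (E := E) ρ =ᶠ[𝓝 w] fun _ => (1 : ℝ) := by
  have hopen : IsOpen {w' : E | ‖w'‖ < ρ / 2} := isOpen_lt continuous_norm continuous_const
  filter_upwards [hopen.mem_nhds hw] with w' hw'
  exact spaceCut_eq_one hρ (le_of_lt hw')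

/-- Near a point with `‖w‖ > 5ρ/8`, `φ_ρ` is the constant `0`. [folklore] -/
theorem spaceCut_eventuallyEq_zero {ρ : ℝ} (hρ : 0 < ρ) {w : E} (hw : 5 * ρ / 8 < ‖w‖) :
    spaceCut (E := E) ρ =ᶠ[𝓝 w] fun _ => (0 : ℝ) := by
  have hopen : IsOpen {w' : E | 5 * ρ / 8 < ‖w'‖} := isOpen_lt continuous_const continuous_norm
  filter_upwards [hopen.mem_nhds hw] with w' hw'
  exact spaceCut_eq_zero hρ (le_of_lt hw')

/-- The gradient of the scaled cut-off: `D φ_ρ(w) = ρ⁻¹ Dφ(ρ⁻¹ w)`. [folklore] -/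
theorem fderiv_spaceCut (ρ : ℝ) (w : E) :
    fderiv ℝ (spaceCut (E := E) ρ) w = ρ⁻¹ • fderiv ℝ (⇑(spaceBump (E := E))) (ρ⁻¹ • w) := by
  rw [spaceCut_def, fderiv_comp_smul ρ⁻¹]

/-- The gradient of `φ_ρ` is `O(1/ρ)` and vanishes off the annulus `ρ/2 ≤ ‖w‖ ≤ 5ρ/8`. [folklore] -/
theorem exists_norm_fderiv_spaceCut_le :
    ∃ M : ℝ, 0 ≤ M ∧ ∀ (ρ : ℝ), 0 < ρ → ∀ w : E,
      ‖fderiv ℝ (spaceCut (E := E) ρ) w‖ ≤ M / ρ ∧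
      (fderiv ℝ (spaceCut (E := E) ρ) w ≠ 0 → ρ / 2 ≤ ‖w‖ ∧ ‖w‖ ≤ 5 * ρ / 8) := by
  obtain ⟨M, hM0, hM⟩ := exists_norm_fderiv_spaceBump_le (E := E)
  refine ⟨M, hM0, fun ρ hρ w => ⟨?_, fun hne => ⟨?_, ?_⟩⟩⟩
  · rw [fderiv_spaceCut, norm_smul, norm_inv, Real.norm_of_nonneg hρ.le, div_eq_inv_mul]
    exact mul_le_mul_of_nonneg_left (hM _) (inv_nonneg.2 hρ.le)
  · refine le_of_not_gt fun h => hne ?_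
    rw [(spaceCut_eventuallyEq_one hρ h).fderiv_eq, fderiv_const_apply]
  · refine le_of_not_gt fun h => hne ?_
    rw [(spaceCut_eventuallyEq_zero hρ h).fderiv_eq, fderiv_const_apply]

/-- The Laplacian of `φ_ρ` is `O(1/ρ²)` and vanishes off the annulus `ρ/2 ≤ ‖w‖ ≤ 5ρ/8`. [folklore] -/
theorem exists_abs_laplacian_spaceCut_le :
    ∃ M : ℝ, 0 ≤ M ∧ ∀ (ρ : ℝ), 0 < ρ → ∀ w : E,
      |(Δ (spaceCut (E := E) ρ)) w| ≤ M / ρ ^ 2 ∧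
      ((Δ (spaceCut (E := E) ρ)) w ≠ 0 → ρ / 2 ≤ ‖w‖ ∧ ‖w‖ ≤ 5 * ρ / 8) := by
  obtain ⟨M, hM0, hM⟩ := exists_abs_laplacian_spaceBump_le (E := E)
  have h2 : ContDiff ℝ 2 (⇑(spaceBump (E := E))) := spaceBump.contDiff
  refine ⟨M, hM0, fun ρ hρ w => ⟨?_, fun hne => ⟨?_, ?_⟩⟩⟩
  · rw [spaceCut_def, laplacian_comp_smul h2 ρ⁻¹ w, smul_eq_mul, abs_mul,
      abs_of_nonneg (by positivity), inv_pow, div_eq_inv_mul]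
    exact mul_le_mul_of_nonneg_left (hM _) (by positivity)
  · refine le_of_not_gt fun h => hne ?_
    rw [(laplacian_congr_nhds (spaceCut_eventuallyEq_one hρ h)).eq_of_nhds, laplacian_const]
  · refine le_of_not_gt fun h => hne ?_
    rw [(laplacian_congr_nhds (spaceCut_eventuallyEq_zero hρ h)).eq_of_nhds, laplacian_const]

/-! ### The spatial factor `Φ_s(w) = φ_ρ(w) G_{ν(4r²+t-s)}(w)` and the test function -/

/-- The spatial factor `Φ_s(w) = φ_ρ(w) · W_{ν(4r² + t - s)}(w)` of Scheffer's test function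
(as a function of `w = x - y`). [folklore] -/
def spaceFactor (ν r ρ t s : ℝ) (w : E) : ℝ :=
  spaceCut ρ w * heatKernel (ν * (4 * r ^ 2 + t - s)) w

/-- Unfolding `spaceFactor`. [folklore] -/
theorem spaceFactor_def (ν r ρ t s : ℝ) :
    spaceFactor (E := E) ν r ρ t s = fun w => spaceCut ρ w * heatKernel (ν * (4 * r ^ 2 + t - s)) w :=
  rfl

/-- The spatial factor is smooth (the space cut-off and the heat kernel are, for every fixed
time, junk times included). [folklore] -/
theorem contDiff_spaceFactor {m : ℕ∞} (ν r ρ t s : ℝ) : ContDiff ℝ m (spaceFactor (E := E) ν r ρ t s) :=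
  (contDiff_spaceCut ρ).mul (contDiff_heatKernel _)

/-- **Scheffer's test function** (Scheffer 1977; Lemarié-Rieusset 2016, §13.9, Step 1, p. 467):
`ψ(s, y) = rⁿ ω((s - t)/ρ², (y - x)/ρ) θ((s - t)/r²) W_{ν(4r² + t - s)}(x - y)` with
`ω(σ, z) = χ(σ) φ(z)` the product cut-off (`χ = timeBump`, `φ = spaceBump`), `θ = timeRamp` and
`W` the heat kernel; `n = dim E` (`= 3` in print, where the prefactor is `r³`). The space cut-off
is composed with `x - y` (as is the kernel), whereas print writes `(y - x)/ρ`: the two differ by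
a sign inside the bump, which is immaterial for every property recorded in this file (all of
them are proved for the function as defined here). [cite: LemarieRieusset2016, §13.9 Step 1 p. 467] -/
def testFn (ν r ρ t : ℝ) (x : E) (s : ℝ) (y : E) : ℝ :=
  r ^ Module.finrank ℝ E * (timeBump ((s - t) / ρ ^ 2) * timeRamp ((s - t) / r ^ 2)) *
    spaceFactor ν r ρ t s (x - y)

/-- Unfolding `testFn`. [folklore] -/
theorem testFn_apply (ν r ρ t : ℝ) (x : E) (s : ℝ) (y : E) :
    testFn ν r ρ t x s y =
      r ^ Module.finrank ℝ E * (timeBump ((s - t) / ρ ^ 2) * timeRamp ((s - t) / r ^ 2)) *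
        (spaceCut ρ (x - y) * heatKernel (ν * (4 * r ^ 2 + t - s)) (x - y)) := rfl

section Properties

variable {ν r ρ t : ℝ} (hν : 0 < ν) (hr : 0 < r) (hrρ : r ≤ ρ / 2)
include hν hr hrρ

omit [FiniteDimensional ℝ E] hν in
/-- `0 < r ≤ ρ/2` forces `ρ > 0`. [folklore] -/
theorem rho_pos : 0 < ρ := by linarith

omit [FiniteDimensional ℝ E] hν in
/-- `0 < r ≤ ρ/2` forces `r² ≤ ρ²/4`. [folklore] -/
theorem sq_le_sq_div_four : r ^ 2 ≤ ρ ^ 2 / 4 := by nlinarith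

omit [FiniteDimensional ℝ E] hr hrρ in
/-- Below `t + 2r²` the variance `σ(s) = ν(4r² + t - s)` exceeds `2νr²`. [folklore] -/
theorem two_mul_le_sigma {s : ℝ} (hs : s - t ≤ 2 * r ^ 2) : 2 * ν * r ^ 2 ≤ ν * (4 * r ^ 2 + t - s) := by
  nlinarith

omit [FiniteDimensional ℝ E] hrρ in
/-- Below `t + 2r²` the variance `σ(s) = ν(4r² + t - s)` is positive. [folklore] -/
theorem sigma_pos {s : ℝ} (hs : s - t ≤ 2 * r ^ 2) : 0 < ν * (4 * r ^ 2 + t - s) :=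
  lt_of_lt_of_le (by positivity) (two_mul_le_sigma hν hs)

omit hν hrρ in
/-- Above `t + 2r²` the time ramp switches the test function off. [folklore] -/
theorem testFn_eq_zero_of_le {s : ℝ} (hs : 2 * r ^ 2 ≤ s - t) (x y : E) : testFn ν r ρ t x s y = 0 := by
  have : timeRamp ((s - t) / r ^ 2) = 0 := timeRamp_of_two_le (by rwa [le_div_iff₀ (by positivity)])
  simp [testFn_apply, this]

omit hrρ in
/-- `ψ ≥ 0`. [cite: LemarieRieusset2016, §13.9 Step 1 p. 467] -/
theorem testFn_nonneg (x : E) (s : ℝ) (y : E) : 0 ≤ testFn ν r ρ t x s y := by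
  rcases le_or_gt (2 * r ^ 2) (s - t) with hs | hs
  · rw [testFn_eq_zero_of_le hr hs]
  · rw [testFn_apply]
    refine mul_nonneg (mul_nonneg (by positivity) (mul_nonneg timeBump.nonneg (timeRamp_nonneg _)))
      (mul_nonneg (spaceCut_nonneg _ _) (heatKernel_pos (sigma_pos hν hr hs.le) _).le)

omit hrρ in
/-- **`ψ ≤ C` everywhere**, `C = (8πν)^{-n/2}`. [cite: LemarieRieusset2016, §13.9 Step 1 p. 467] -/
theorem testFn_le (x : E) (s : ℝ) (y : E) :
    testFn ν r ρ t x s y ≤ (8 * π * ν) ^ (-(Module.finrank ℝ E : ℝ) / 2) := by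
  set n := Module.finrank ℝ E with hn
  rcases le_or_gt (2 * r ^ 2) (s - t) with hs | hs
  · rw [testFn_eq_zero_of_le hr hs]; positivity
  · rw [testFn_apply]
    have hG : heatKernel (ν * (4 * r ^ 2 + t - s)) (x - y) ≤ (8 * π * ν) ^ (-(n : ℝ) / 2) * (r ^ n)⁻¹ := by
      refine (heatKernel_le_peak (by positivity) (two_mul_le_sigma hν hs.le) (x - y)).trans_eq ?_
      rw [hn, show 4 * π * (2 * ν * r ^ 2) = (8 * π * ν) * r ^ 2 by ring,
        mul_sq_rpow_neg_half _ (by positivity) hr.le]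
    have hGpos := (heatKernel_pos (sigma_pos hν hr hs.le) (x - y)).le
    have hA : timeBump ((s - t) / ρ ^ 2) * timeRamp ((s - t) / r ^ 2) ≤ 1 :=
      mul_le_one₀ timeBump.le_one (timeRamp_nonneg _) (timeRamp_le_one _)
    have hB : spaceCut ρ (x - y) * heatKernel (ν * (4 * r ^ 2 + t - s)) (x - y) ≤
        1 * ((8 * π * ν) ^ (-(n : ℝ) / 2) * (r ^ n)⁻¹) :=
      mul_le_mul (spaceCut_le_one _ _) hG hGpos zero_le_one
    calc r ^ n * (timeBump ((s - t) / ρ ^ 2) * timeRamp ((s - t) / r ^ 2)) *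
          (spaceCut ρ (x - y) * heatKernel (ν * (4 * r ^ 2 + t - s)) (x - y))
        ≤ r ^ n * 1 * (1 * ((8 * π * ν) ^ (-(n : ℝ) / 2) * (r ^ n)⁻¹)) :=
          mul_le_mul (mul_le_mul_of_nonneg_left hA (by positivity)) hB
            (mul_nonneg (spaceCut_nonneg _ _) hGpos) (by positivity)
      _ = (8 * π * ν) ^ (-(n : ℝ) / 2) := by field_simp

omit hν in
/-- **Support**: `ψ(s, y) ≠ 0` forces `|s - t| < ρ²/2` and `‖y - x‖ < 5ρ/8 (< 3ρ/4)`; in particular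
`ψ` is supported in `(t - ρ², t + ρ²) × B(x, 3ρ/4) ⊆ Q_ρ(t, x)`. [cite: LemarieRieusset2016, §13.9 Step 1 p. 467] -/
theorem abs_lt_and_norm_lt_of_testFn_ne_zero {x : E} {s : ℝ} {y : E} (h : testFn ν r ρ t x s y ≠ 0) :
    |s - t| < ρ ^ 2 / 2 ∧ ‖y - x‖ < 5 * ρ / 8 := by
  have hρ := rho_pos hr hrρ
  rw [testFn_apply] at h
  have h1 : timeBump ((s - t) / ρ ^ 2) ≠ 0 := fun h0 => h (by simp [h0])
  have h2 : spaceCut ρ (x - y) ≠ 0 := fun h0 => h (by simp [h0])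
  refine ⟨?_, ?_⟩
  · have := abs_lt_of_timeBump_ne_zero h1
    rw [abs_div, abs_of_pos (by positivity : (0:ℝ) < ρ ^ 2), div_lt_iff₀ (by positivity)] at this
    linarith
  · rw [norm_sub_rev]
    exact norm_lt_of_spaceCut_ne_zero hρ h2

/-- **Lower bound on the small cylinder**: `ψ ≥ (20πν)^{-n/2} e^{-1/(12ν)}` on `Q_r(t, x)`. [cite: LemarieRieusset2016, §13.9 Step 1 p. 467] -/
theorem le_testFn_of_mem {x : E} {s : ℝ} {y : E} (h : (s, y) ∈ parabolicCylinderCentered r (t, x)) :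
    (20 * π * ν) ^ (-(Module.finrank ℝ E : ℝ) / 2) * Real.exp (-(1 / (12 * ν))) ≤
      testFn ν r ρ t x s y := by
  set n := Module.finrank ℝ E with hn
  have hρ := rho_pos hr hrρ
  have hr2 := sq_le_sq_div_four hr hrρ
  rw [mem_parabolicCylinderCentered] at h
  obtain ⟨⟨hs1, hs2⟩, hy⟩ := h
  simp only at hs1 hs2 hy
  rw [dist_eq_norm, ← norm_sub_rev] at hy
  -- the cut-offs are `1`
  have htb : timeBump ((s - t) / ρ ^ 2) = 1 := by
    refine timeBump_eq_one ?_
    rw [abs_div, abs_of_pos (by positivity : (0:ℝ) < ρ ^ 2), div_le_iff₀ (by positivity)]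
    have : |s - t| < r ^ 2 := abs_lt.2 ⟨by linarith, by linarith⟩
    linarith
  have hramp : timeRamp ((s - t) / r ^ 2) = 1 :=
    timeRamp_of_le_one (by rw [div_le_one (by positivity)]; linarith)
  have hsc : spaceCut ρ (x - y) = 1 := spaceCut_eq_one hρ (by linarith)
  -- the heat kernel is large
  have hσ : 0 < ν * (4 * r ^ 2 + t - s) := by nlinarith
  have hG : (20 * π * ν) ^ (-(n : ℝ) / 2) * (r ^ n)⁻¹ * Real.exp (-(1 / (12 * ν))) ≤
      heatKernel (ν * (4 * r ^ 2 + t - s)) (x - y) := by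
    rw [heatKernel, ← hn]
    refine mul_le_mul ?_ ?_ (by positivity) (by positivity)
    · rw [← mul_sq_rpow_neg_half n (by positivity) hr.le]
      refine Real.rpow_le_rpow_of_nonpos (by positivity) ?_ ?_
      · have h5 : 4 * r ^ 2 + t - s ≤ 5 * r ^ 2 := by linarith
        have hc : (0 : ℝ) ≤ 4 * π * ν := by positivity
        calc 4 * π * (ν * (4 * r ^ 2 + t - s)) = (4 * π * ν) * (4 * r ^ 2 + t - s) := by ring
          _ ≤ (4 * π * ν) * (5 * r ^ 2) := mul_le_mul_of_nonneg_left h5 hc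
          _ = 20 * π * ν * r ^ 2 := by ring
      · have : (0 : ℝ) ≤ n := Nat.cast_nonneg _
        linarith [div_nonneg this zero_le_two]
    · refine Real.exp_le_exp.2 ?_
      rw [neg_div, neg_le_neg_iff, div_le_div_iff₀ (by positivity) (by positivity), one_mul]
      have h1 : ‖x - y‖ ^ 2 ≤ r ^ 2 := pow_le_pow_left₀ (norm_nonneg _) hy.le 2
      nlinarith
  calc (20 * π * ν) ^ (-(n : ℝ) / 2) * Real.exp (-(1 / (12 * ν)))
      = r ^ n * (1 * 1) * (1 * ((20 * π * ν) ^ (-(n : ℝ) / 2) * (r ^ n)⁻¹ *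
          Real.exp (-(1 / (12 * ν))))) := by field_simp
    _ ≤ testFn ν r ρ t x s y := by
        rw [testFn_apply, htb, hramp, hsc]
        gcongr

/-- **`ψ` is a test function on `Q_ρ(t, x)`**: smooth on `ℝ × E` (the time ramp vanishes for
`s ≥ t + 2r²`, before the backward heat kernel becomes singular at `s = t + 4r²`), compactly
supported, with `tsupport ψ ⊆ [t - ρ²/2, t + ρ²/2] × B̄(x, 5ρ/8) ⊆ Q_ρ(t, x)`. [cite: LemarieRieusset2016, §13.9 Step 1 p. 467] -/
theorem isSpaceTimeTestOn_testFn (x : E) :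
    IsSpaceTimeTestOn (parabolicCylinderCenteredOpens ρ (t, x)) (testFn ν r ρ t x) := by
  have hρ := rho_pos hr hrρ
  set n := Module.finrank ℝ E with hn
  set K : Set (ℝ × E) := Icc (t - ρ ^ 2 / 2) (t + ρ ^ 2 / 2) ×ˢ closedBall x (5 * ρ / 8) with hK
  have hKc : IsCompact K := isCompact_Icc.prod (isCompact_closedBall _ _)
  have hzero : ∀ q : ℝ × E, q ∉ K → uncurry (testFn ν r ρ t x) q = 0 := by
    intro q hq
    by_contra h
    obtain ⟨h1, h2⟩ := abs_lt_and_norm_lt_of_testFn_ne_zero hr hrρ h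
    refine hq ⟨⟨?_, ?_⟩, ?_⟩
    · linarith [(abs_lt.1 h1).1]
    · linarith [(abs_lt.1 h1).2]
    · rw [mem_closedBall, dist_eq_norm]; exact h2.le
  have hKQ : K ⊆ parabolicCylinderCentered ρ ((t, x) : ℝ × E) := by
    rintro ⟨s, y⟩ ⟨⟨hs1, hs2⟩, hy⟩
    rw [mem_parabolicCylinderCentered]
    refine ⟨⟨?_, ?_⟩, ?_⟩
    · change t - ρ ^ 2 < s
      nlinarith
    · change s < t + ρ ^ 2
      nlinarith
    · change dist y x < ρ
      rw [mem_closedBall] at hy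
      linarith
  refine ⟨?_, HasCompactSupport.intro hKc hzero, ?_⟩
  · -- smoothness
    rw [contDiff_iff_contDiffAt]
    intro q
    rcases lt_or_ge q.1 (t + 4 * r ^ 2) with hq | hq
    · have heq : uncurry (testFn ν r ρ t x) = fun q : ℝ × E =>
          r ^ n * (timeBump ((q.1 - t) / ρ ^ 2) * timeRamp ((q.1 - t) / r ^ 2)) *
            (spaceCut ρ (x - q.2) * kernel ν r t x q.1 q.2) := rfl
      rw [heq]
      have hU : Iio (t + 4 * r ^ 2) ×ˢ (univ : Set E) ∈ 𝓝 q :=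
        (isOpen_Iio.prod isOpen_univ).mem_nhds ⟨hq, mem_univ _⟩
      have hk : ContDiffAt ℝ ∞ (fun q : ℝ × E => kernel ν r t x q.1 q.2) q :=
        (contDiffOn_uncurry_kernel hν r t x).contDiffAt hU
      have h1 : ContDiff ℝ ∞ (fun q : ℝ × E => timeBump ((q.1 - t) / ρ ^ 2)) :=
        timeBump.contDiff.comp ((contDiff_fst.sub contDiff_const).div_const _)
      have h2 : ContDiff ℝ ∞ (fun q : ℝ × E => timeRamp ((q.1 - t) / r ^ 2)) :=
        contDiff_timeRamp.comp ((contDiff_fst.sub contDiff_const).div_const _)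
      have h3 : ContDiff ℝ ∞ (fun q : ℝ × E => spaceCut ρ (x - q.2)) :=
        (contDiff_spaceCut ρ).comp (contDiff_const.sub contDiff_snd)
      exact (contDiffAt_const.mul (h1.mul h2).contDiffAt).mul (h3.contDiffAt.mul hk)
    · -- above `t + 4r² > t + 2r²` the function vanishes identically nearby
      have hU : {q' : ℝ × E | t + 2 * r ^ 2 < q'.1} ∈ 𝓝 q :=
        (isOpen_lt continuous_const continuous_fst).mem_nhds (by
          show t + 2 * r ^ 2 < q.1
          nlinarith)
      refine (contDiffAt_const (c := (0 : ℝ))).congr_of_eventuallyEq ?_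
      filter_upwards [hU] with q' hq'
      exact testFn_eq_zero_of_le hr (by linarith [hq']) x q'.2
  · have hsub : support (uncurry (testFn ν r ρ t x)) ⊆ K := fun q hq =>
      Classical.not_not.1 fun h => hq (hzero q h)
    exact (closure_minimal hsub hKc.isClosed).trans hKQ

end Properties

/-! ### The gradient bound -/

/-- The gradient of the spatial factor: `DΦ_s(w) = φ_ρ(w) DG_σ(w) + G_σ(w) Dφ_ρ(w)`. [folklore] -/
theorem fderiv_spaceFactor (ν r ρ t s : ℝ) (w : E) :
    fderiv ℝ (spaceFactor (E := E) ν r ρ t s) w =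
      spaceCut ρ w • fderiv ℝ (heatKernel (ν * (4 * r ^ 2 + t - s))) w +
        heatKernel (ν * (4 * r ^ 2 + t - s)) w • fderiv ℝ (spaceCut (E := E) ρ) w := by
  have hc : DifferentiableAt ℝ (spaceCut (E := E) ρ) w :=
    ((contDiff_spaceCut (m := 1) ρ).differentiable one_ne_zero) w
  have hd : DifferentiableAt ℝ (heatKernel (E := E) (ν * (4 * r ^ 2 + t - s))) w :=
    ((contDiff_heatKernel (m := 1) _).differentiable one_ne_zero) w
  rw [spaceFactor_def, fderiv_fun_mul hc hd]

/-- **Gradient bound** `‖∇_y ψ(s, y)‖ ≤ C/r` (Lemarié-Rieusset 2016, p. 467: "`|∇ψ(s, y)| ≤ C r⁻¹`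
on `Q_ρ(t, x)`"; here everywhere), with `C = C(ν, n)`. [cite: LemarieRieusset2016, §13.9 Step 1 p. 467] -/
theorem exists_norm_fderiv_testFn_le {ν : ℝ} (hν : 0 < ν) :
    ∃ C : ℝ, 0 ≤ C ∧ ∀ (t : ℝ) (x : E) (r ρ : ℝ), 0 < r → r ≤ ρ / 2 → ∀ (s : ℝ) (y : E),
      ‖fderiv ℝ (testFn ν r ρ t x s) y‖ ≤ C / r := by
  set n := Module.finrank ℝ E with hn
  obtain ⟨M, hM0, hM⟩ := exists_norm_fderiv_spaceCut_le (E := E)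
  set P : ℝ := (8 * π * ν) ^ (-(n : ℝ) / 2) with hP
  have hP0 : 0 ≤ P := by positivity
  refine ⟨P * ((Real.sqrt (2 * ν))⁻¹ + M / 2), by positivity, fun t x r ρ hr hrρ s y => ?_⟩
  have hρ : 0 < ρ := by linarith
  rcases le_or_gt (2 * r ^ 2) (s - t) with hs | hs
  · have : testFn ν r ρ t x s = fun _ => 0 := funext fun y => testFn_eq_zero_of_le hr hs x y
    rw [this, fderiv_const_apply, norm_zero]
    positivity
  -- the slice is `y ↦ A Φ_s(x - y)`
  set σ := ν * (4 * r ^ 2 + t - s) with hσdef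
  have hσ0 : 2 * ν * r ^ 2 ≤ σ := two_mul_le_sigma hν hs.le
  have hσ : 0 < σ := lt_of_lt_of_le (by positivity) hσ0
  set A := r ^ n * (timeBump ((s - t) / ρ ^ 2) * timeRamp ((s - t) / r ^ 2)) with hA
  have hA0 : 0 ≤ A := mul_nonneg (by positivity) (mul_nonneg timeBump.nonneg (timeRamp_nonneg _))
  have hA1 : A ≤ r ^ n := by
    rw [hA]
    exact mul_le_of_le_one_right (by positivity)
      (mul_le_one₀ timeBump.le_one (timeRamp_nonneg _) (timeRamp_le_one _))
  have hslice : testFn ν r ρ t x s = fun y => A * spaceFactor ν r ρ t s (x - y) := rfl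
  have hΦ1 : ContDiff ℝ 1 (spaceFactor (E := E) ν r ρ t s) := contDiff_spaceFactor _ _ _ _ _
  have hdiff : DifferentiableAt ℝ (fun y => spaceFactor ν r ρ t s (x - y)) y :=
    ((hΦ1.comp (contDiff_const.sub contDiff_id)).differentiable one_ne_zero) y
  rw [hslice, fderiv_const_mul hdiff, norm_smul, Real.norm_of_nonneg hA0,
    norm_fderiv_comp_sub_left hΦ1]
  -- the gradient of the spatial factor
  set w := x - y with hw
  have hG : heatKernel σ w ≤ P * (r ^ n)⁻¹ := by
    refine (heatKernel_le_peak (by positivity) hσ0 w).trans_eq ?_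
    rw [hP, show 4 * π * (2 * ν * r ^ 2) = (8 * π * ν) * r ^ 2 by ring,
      mul_sq_rpow_neg_half _ (by positivity) hr.le]
  have hDG : ‖fderiv ℝ (heatKernel σ) w‖ ≤ P * (r ^ n)⁻¹ * ((Real.sqrt (2 * ν))⁻¹ * r⁻¹) := by
    refine (norm_fderiv_heatKernel_le_peak (by positivity) hσ0 w).trans_eq ?_
    rw [hP, show 4 * π * (2 * ν * r ^ 2) = (8 * π * ν) * r ^ 2 by ring,
      mul_sq_rpow_neg_half _ (by positivity) hr.le, Real.sqrt_mul (by positivity),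
      Real.sqrt_sq hr.le, mul_inv]
  have hDΦ : ‖fderiv ℝ (spaceFactor ν r ρ t s) w‖ ≤
      P * (r ^ n)⁻¹ * ((Real.sqrt (2 * ν))⁻¹ * r⁻¹) + P * (r ^ n)⁻¹ * (M / ρ) := by
    rw [fderiv_spaceFactor]
    refine (norm_add_le _ _).trans (add_le_add ?_ ?_)
    · rw [norm_smul, Real.norm_of_nonneg (spaceCut_nonneg _ _)]
      exact (mul_le_of_le_one_left (norm_nonneg _) (spaceCut_le_one _ _)).trans hDG
    · rw [norm_smul, Real.norm_of_nonneg (heatKernel_pos hσ w).le]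
      exact mul_le_mul hG (hM ρ hρ w).1 (norm_nonneg _) (by positivity)
  have hρr : M / ρ ≤ M / 2 * r⁻¹ :=
    calc M / ρ ≤ M / (2 * r) := div_le_div_of_nonneg_left hM0 (by positivity) (by linarith)
      _ = M / 2 * r⁻¹ := by field_simp
  calc A * ‖fderiv ℝ (spaceFactor ν r ρ t s) w‖
      ≤ r ^ n * (P * (r ^ n)⁻¹ * ((Real.sqrt (2 * ν))⁻¹ * r⁻¹) + P * (r ^ n)⁻¹ * (M / 2 * r⁻¹)) := by
        refine mul_le_mul hA1 (hDΦ.trans ?_) (norm_nonneg _) (by positivity)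
        gcongr
    _ = P * ((Real.sqrt (2 * ν))⁻¹ + M / 2) / r := by
        field_simp

/-! ### The heat-operator bound -/

/-- **The backward heat operator applied to `ψ`** (Lemarié-Rieusset 2016, p. 467: "for
`(s, y) ∈ Q_ρ(t, x)` with `s < t + r²`, we have `|(∂_s + νΔ_y)ψ(s, y)| ≤ C r³/ρ⁵`"; here for all
`y`, in dimension `n`: `≤ C rⁿ/ρⁿ⁺²`, `C = C(ν, n)`). Below `t + r²` the time ramp is `1`, the
kernel `K` is caloric (`∂_s K + νΔ_y K = 0`), and what is left,
`rⁿ [ρ⁻² χ'(·) φ_ρ K + ν χ (K Δφ_ρ + 2 ∇φ_ρ · ∇K)]`, lives where a derivative of the cut-off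
`ω` is non-zero, i.e. off `Q_{ρ/2}(t, x)`, where `K ≤ C ρ⁻ⁿ` and `|∇K| ≤ C ρ⁻ⁿ⁻¹`. [cite: LemarieRieusset2016, §13.9 Step 1 p. 467] -/
theorem exists_abs_heat_testFn_le {ν : ℝ} (hν : 0 < ν) :
    ∃ C : ℝ, 0 ≤ C ∧ ∀ (t : ℝ) (x : E) (r ρ : ℝ), 0 < r → r ≤ ρ / 2 → ∀ (s : ℝ) (y : E),
      s < t + r ^ 2 →
      |timeDeriv (testFn ν r ρ t x) s y + ν * (Δ (testFn ν r ρ t x s)) y| ≤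
        C * r ^ Module.finrank ℝ E / ρ ^ (Module.finrank ℝ E + 2) := by
  obtain ⟨Mt, hMt0, hMt⟩ := exists_abs_deriv_timeBump_le
  obtain ⟨M₁, hM₁0, hM₁⟩ := exists_norm_fderiv_spaceCut_le (E := E)
  obtain ⟨M₂, hM₂0, hM₂⟩ := exists_abs_laplacian_spaceCut_le (E := E)
  obtain ⟨C₀, hC₀0, hC₀⟩ := exists_heatKernel_le_div_pow (E := E)
  obtain ⟨C₁, hC₁0, hC₁⟩ := exists_norm_fderiv_heatKernel_le_div_pow (E := E)
  have hP0 : 0 ≤ (π * ν) ^ (-(Module.finrank ℝ E : ℝ) / 2) := by positivity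
  refine ⟨Mt * (π * ν) ^ (-(Module.finrank ℝ E : ℝ) / 2) +
      ν * (2 ^ Module.finrank ℝ E * C₀ * M₂ + 2 * (M₁ * (2 ^ (Module.finrank ℝ E + 1) * C₁))), by positivity,
    fun t x r ρ hr hrρ s y hs => ?_⟩
  have hρ : 0 < ρ := by linarith
  have hr2 : r ^ 2 ≤ ρ ^ 2 / 4 := by nlinarith
  have hst : s - t ≤ 2 * r ^ 2 := by nlinarith
  have hσ : 0 < (ν * (4 * r ^ 2 + t - s)) := sigma_pos hν hr hst
  set b := stdOrthonormalBasis ℝ E with hb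
  -- Step 1: the time derivative (the ramp is `1` below `t + r²`)
  have hramp : ∀ s', s' < t + r ^ 2 → timeRamp ((s' - t) / r ^ 2) = 1 := fun s' hs' =>
    timeRamp_of_le_one (by rw [div_le_one (by positivity)]; linarith)
  have hF : (fun s' => testFn ν r ρ t x s' y) =ᶠ[𝓝 s]
      fun s' => r ^ Module.finrank ℝ E * (timeBump ((s' - t) / ρ ^ 2) * (spaceCut ρ (x - y) * kernel ν r t x s' y)) := by
    filter_upwards [Iio_mem_nhds hs] with s' hs'
    rw [testFn_apply, hramp s' hs', kernel_apply]
    ring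
  have htb_deriv : HasDerivAt (fun s' => timeBump ((s' - t) / ρ ^ 2)) (deriv (⇑timeBump) ((s - t) / ρ ^ 2) * (1 / ρ ^ 2)) s := by
    have hin : HasDerivAt (fun s' => (s' - t) / ρ ^ 2) (1 / ρ ^ 2) s := by
      simpa using ((hasDerivAt_id s).sub_const t).div_const (ρ ^ 2)
    have hout : HasDerivAt (fun τ : ℝ => timeBump τ) (deriv (⇑timeBump) ((s - t) / ρ ^ 2)) ((s - t) / ρ ^ 2) :=
      (((timeBump.contDiff (n := 1)).differentiable one_ne_zero) _).hasDerivAt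
    have hcomp := HasDerivAt.comp s (h₂ := fun τ : ℝ => timeBump τ) hout hin
    simpa [Function.comp_def] using hcomp
  have hK := hasDerivAt_kernel hσ x y
  have hderiv : timeDeriv (testFn ν r ρ t x) s y =
      r ^ Module.finrank ℝ E * (deriv (⇑timeBump) ((s - t) / ρ ^ 2) * (1 / ρ ^ 2) * (spaceCut ρ (x - y) * heatKernel (ν * (4 * r ^ 2 + t - s)) (x - y)) +
        timeBump ((s - t) / ρ ^ 2) * (spaceCut ρ (x - y) * ((‖x - y‖ ^ 2 / (4 * (ν * (4 * r ^ 2 + t - s)) ^ 2) - (Module.finrank ℝ E : ℝ) / (2 * (ν * (4 * r ^ 2 + t - s)))) * heatKernel (ν * (4 * r ^ 2 + t - s)) (x - y) * (-ν)))) := by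
    rw [timeDeriv, hF.deriv_eq]
    exact ((htb_deriv.mul (hK.const_mul (spaceCut ρ (x - y)))).const_mul (r ^ Module.finrank ℝ E)).deriv
  -- Step 2: the Laplacian of the slice
  have hslice : testFn ν r ρ t x s = (r ^ Module.finrank ℝ E * timeBump ((s - t) / ρ ^ 2)) • fun y' => spaceFactor ν r ρ t s (x - y') := by
    funext y'
    rw [Pi.smul_apply, smul_eq_mul, testFn, hramp s hs, mul_one]
  have hΦ2 : ContDiff ℝ 2 (spaceFactor (E := E) ν r ρ t s) := contDiff_spaceFactor _ _ _ _ _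
  have hcomp2 : ContDiffAt ℝ 2 (fun y' => spaceFactor ν r ρ t s (x - y')) y :=
    (hΦ2.comp (contDiff_const.sub contDiff_id)).contDiffAt
  have hlap : (Δ (testFn ν r ρ t x s)) y =
      r ^ Module.finrank ℝ E * timeBump ((s - t) / ρ ^ 2) * (spaceCut ρ (x - y) * ((‖x - y‖ ^ 2 / (4 * (ν * (4 * r ^ 2 + t - s)) ^ 2) - (Module.finrank ℝ E : ℝ) / (2 * (ν * (4 * r ^ 2 + t - s)))) * heatKernel (ν * (4 * r ^ 2 + t - s)) (x - y)) + heatKernel (ν * (4 * r ^ 2 + t - s)) (x - y) * (Δ (spaceCut (E := E) ρ)) (x - y) + 2 * (∑ i, fderiv ℝ (spaceCut (E := E) ρ) (x - y) (b i) * fderiv ℝ (heatKernel (ν * (4 * r ^ 2 + t - s))) (x - y) (b i))) := by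
    rw [hslice, laplacian_smul (r ^ Module.finrank ℝ E * timeBump ((s - t) / ρ ^ 2)) hcomp2, smul_eq_mul,
      laplacian_comp_sub_left hΦ2 x y, spaceFactor_def,
      laplacian_mul_eq b (contDiff_spaceCut ρ) (contDiff_heatKernel _) (x - y), laplacian_heatKernel]
  -- Step 3: combine; the caloric terms cancel
  have hsum : timeDeriv (testFn ν r ρ t x) s y + ν * (Δ (testFn ν r ρ t x s)) y =
      r ^ Module.finrank ℝ E * (deriv (⇑timeBump) ((s - t) / ρ ^ 2) * (1 / ρ ^ 2) * (spaceCut ρ (x - y) * heatKernel (ν * (4 * r ^ 2 + t - s)) (x - y)) +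
        ν * timeBump ((s - t) / ρ ^ 2) * (heatKernel (ν * (4 * r ^ 2 + t - s)) (x - y) * (Δ (spaceCut (E := E) ρ)) (x - y) + 2 * (∑ i, fderiv ℝ (spaceCut (E := E) ρ) (x - y) (b i) * fderiv ℝ (heatKernel (ν * (4 * r ^ 2 + t - s))) (x - y) (b i)))) := by
    rw [hderiv, hlap]; ring
  -- Step 4: bounds on the three remaining terms
  have hsc0 : 0 ≤ spaceCut ρ (x - y) := spaceCut_nonneg _ _
  have hsc1 : spaceCut ρ (x - y) ≤ 1 := spaceCut_le_one _ _
  have htb0 : 0 ≤ timeBump ((s - t) / ρ ^ 2) := timeBump.nonneg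
  have htb1 : timeBump ((s - t) / ρ ^ 2) ≤ 1 := timeBump.le_one
  have hG0 : 0 ≤ heatKernel (ν * (4 * r ^ 2 + t - s)) (x - y) := (heatKernel_pos hσ _).le
  -- (a) the time cut-off term lives where `t - s ≥ ρ²/4`
  have ha : |deriv (⇑timeBump) ((s - t) / ρ ^ 2)| * heatKernel (ν * (4 * r ^ 2 + t - s)) (x - y) ≤ Mt * ((π * ν) ^ (-(Module.finrank ℝ E : ℝ) / 2) * (ρ ^ Module.finrank ℝ E)⁻¹) := by
    rcases eq_or_ne (deriv (⇑timeBump) ((s - t) / ρ ^ 2)) 0 with h0 | h0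
    · rw [h0, abs_zero, zero_mul]; positivity
    · have h1 := abs_ge_of_deriv_timeBump_ne_zero h0
      have h2 : ρ ^ 2 / 4 ≤ t - s := by
        rw [abs_div, abs_of_pos (by positivity : (0:ℝ) < ρ ^ 2), le_div_iff₀ (by positivity)] at h1
        rcases le_abs.1 h1 with h | h
        · exfalso; linarith
        · linarith
      have hσ0 : ν * ρ ^ 2 / 4 ≤ (ν * (4 * r ^ 2 + t - s)) := by nlinarith
      have hGle : heatKernel (ν * (4 * r ^ 2 + t - s)) (x - y) ≤ (π * ν) ^ (-(Module.finrank ℝ E : ℝ) / 2) * (ρ ^ Module.finrank ℝ E)⁻¹ := by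
        refine (heatKernel_le_peak (by positivity) hσ0 _).trans_eq ?_
        rw [show 4 * π * (ν * ρ ^ 2 / 4) = (π * ν) * ρ ^ 2 by ring,
          mul_sq_rpow_neg_half _ (by positivity) hρ.le]
      exact mul_le_mul (hMt _) hGle hG0 hMt0
  -- (b) the Laplacian of the space cut-off lives on the annulus `ρ/2 ≤ ‖x - y‖`
  have hb' : heatKernel (ν * (4 * r ^ 2 + t - s)) (x - y) * |(Δ (spaceCut (E := E) ρ)) (x - y)| ≤ 2 ^ Module.finrank ℝ E * C₀ * (ρ ^ Module.finrank ℝ E)⁻¹ * (M₂ / ρ ^ 2) := by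
    rcases eq_or_ne ((Δ (spaceCut (E := E) ρ)) (x - y)) 0 with h0 | h0
    · rw [h0, abs_zero, mul_zero]; positivity
    · obtain ⟨hw1, -⟩ := (hM₂ ρ hρ (x - y)).2 h0
      have hGle : heatKernel (ν * (4 * r ^ 2 + t - s)) (x - y) ≤ 2 ^ Module.finrank ℝ E * C₀ * (ρ ^ Module.finrank ℝ E)⁻¹ := by
        refine (hC₀ _ (ρ / 2) (x - y) hσ (by positivity) hw1).trans_eq ?_
        rw [div_pow]
        field_simp
      exact mul_le_mul hGle (hM₂ ρ hρ (x - y)).1 (abs_nonneg _) (by positivity)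
  -- (c) so does the gradient of the space cut-off
  have hc' : |(∑ i, fderiv ℝ (spaceCut (E := E) ρ) (x - y) (b i) * fderiv ℝ (heatKernel (ν * (4 * r ^ 2 + t - s))) (x - y) (b i))| ≤ M₁ / ρ * (2 ^ (Module.finrank ℝ E + 1) * C₁ * (ρ ^ (Module.finrank ℝ E + 1))⁻¹) := by
    have hCS := abs_sum_fderiv_mul_fderiv_le b (spaceCut (E := E) ρ) (heatKernel (ν * (4 * r ^ 2 + t - s))) (x - y)
    rcases eq_or_ne (fderiv ℝ (spaceCut (E := E) ρ) (x - y)) 0 with h0 | h0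
    · refine hCS.trans ?_
      rw [h0, norm_zero, zero_mul]; positivity
    · obtain ⟨hw1, -⟩ := (hM₁ ρ hρ (x - y)).2 h0
      have hDG : ‖fderiv ℝ (heatKernel (ν * (4 * r ^ 2 + t - s))) (x - y)‖ ≤ 2 ^ (Module.finrank ℝ E + 1) * C₁ * (ρ ^ (Module.finrank ℝ E + 1))⁻¹ := by
        refine (hC₁ _ (ρ / 2) (x - y) hσ (by positivity) hw1).trans_eq ?_
        rw [div_pow]
        field_simp
      exact hCS.trans (mul_le_mul (hM₁ ρ hρ (x - y)).1 hDG (norm_nonneg _) (by positivity))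
  -- assemble
  have htri : |deriv (⇑timeBump) ((s - t) / ρ ^ 2) * (1 / ρ ^ 2) * (spaceCut ρ (x - y) * heatKernel (ν * (4 * r ^ 2 + t - s)) (x - y)) + ν * timeBump ((s - t) / ρ ^ 2) * (heatKernel (ν * (4 * r ^ 2 + t - s)) (x - y) * (Δ (spaceCut (E := E) ρ)) (x - y) + 2 * (∑ i, fderiv ℝ (spaceCut (E := E) ρ) (x - y) (b i) * fderiv ℝ (heatKernel (ν * (4 * r ^ 2 + t - s))) (x - y) (b i)))| ≤
      |deriv (⇑timeBump) ((s - t) / ρ ^ 2)| * heatKernel (ν * (4 * r ^ 2 + t - s)) (x - y) * (1 / ρ ^ 2) + ν * (heatKernel (ν * (4 * r ^ 2 + t - s)) (x - y) * |(Δ (spaceCut (E := E) ρ)) (x - y)| + 2 * |(∑ i, fderiv ℝ (spaceCut (E := E) ρ) (x - y) (b i) * fderiv ℝ (heatKernel (ν * (4 * r ^ 2 + t - s))) (x - y) (b i))|) := by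
    refine (abs_add_le _ _).trans (add_le_add ?_ ?_)
    · calc |deriv (⇑timeBump) ((s - t) / ρ ^ 2) * (1 / ρ ^ 2) * (spaceCut ρ (x - y) * heatKernel (ν * (4 * r ^ 2 + t - s)) (x - y))|
          = |deriv (⇑timeBump) ((s - t) / ρ ^ 2)| * (1 / ρ ^ 2) * (spaceCut ρ (x - y) * heatKernel (ν * (4 * r ^ 2 + t - s)) (x - y)) := by
            rw [abs_mul, abs_mul, abs_of_nonneg (by positivity : (0:ℝ) ≤ 1 / ρ ^ 2),
              abs_of_nonneg (mul_nonneg hsc0 hG0)]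
        _ ≤ |deriv (⇑timeBump) ((s - t) / ρ ^ 2)| * (1 / ρ ^ 2) * (1 * heatKernel (ν * (4 * r ^ 2 + t - s)) (x - y)) := by gcongr
        _ = |deriv (⇑timeBump) ((s - t) / ρ ^ 2)| * heatKernel (ν * (4 * r ^ 2 + t - s)) (x - y) * (1 / ρ ^ 2) := by ring
    · have hX : |heatKernel (ν * (4 * r ^ 2 + t - s)) (x - y) * (Δ (spaceCut (E := E) ρ)) (x - y) + 2 * (∑ i, fderiv ℝ (spaceCut (E := E) ρ) (x - y) (b i) * fderiv ℝ (heatKernel (ν * (4 * r ^ 2 + t - s))) (x - y) (b i))| ≤ heatKernel (ν * (4 * r ^ 2 + t - s)) (x - y) * |(Δ (spaceCut (E := E) ρ)) (x - y)| + 2 * |(∑ i, fderiv ℝ (spaceCut (E := E) ρ) (x - y) (b i) * fderiv ℝ (heatKernel (ν * (4 * r ^ 2 + t - s))) (x - y) (b i))| := by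
        refine (abs_add_le _ _).trans_eq ?_
        rw [abs_mul, abs_of_nonneg hG0, abs_mul, abs_two]
      calc |ν * timeBump ((s - t) / ρ ^ 2) * (heatKernel (ν * (4 * r ^ 2 + t - s)) (x - y) * (Δ (spaceCut (E := E) ρ)) (x - y) + 2 * (∑ i, fderiv ℝ (spaceCut (E := E) ρ) (x - y) (b i) * fderiv ℝ (heatKernel (ν * (4 * r ^ 2 + t - s))) (x - y) (b i)))|
          = ν * timeBump ((s - t) / ρ ^ 2) * |heatKernel (ν * (4 * r ^ 2 + t - s)) (x - y) * (Δ (spaceCut (E := E) ρ)) (x - y) + 2 * (∑ i, fderiv ℝ (spaceCut (E := E) ρ) (x - y) (b i) * fderiv ℝ (heatKernel (ν * (4 * r ^ 2 + t - s))) (x - y) (b i))| := by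
            rw [abs_mul, abs_mul, abs_of_nonneg hν.le, abs_of_nonneg htb0]
        _ ≤ ν * 1 * (heatKernel (ν * (4 * r ^ 2 + t - s)) (x - y) * |(Δ (spaceCut (E := E) ρ)) (x - y)| + 2 * |(∑ i, fderiv ℝ (spaceCut (E := E) ρ) (x - y) (b i) * fderiv ℝ (heatKernel (ν * (4 * r ^ 2 + t - s))) (x - y) (b i))|) := by gcongr
        _ = ν * (heatKernel (ν * (4 * r ^ 2 + t - s)) (x - y) * |(Δ (spaceCut (E := E) ρ)) (x - y)| + 2 * |(∑ i, fderiv ℝ (spaceCut (E := E) ρ) (x - y) (b i) * fderiv ℝ (heatKernel (ν * (4 * r ^ 2 + t - s))) (x - y) (b i))|) := by ring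
  rw [hsum, abs_mul, abs_of_nonneg (by positivity : (0:ℝ) ≤ r ^ Module.finrank ℝ E)]
  calc r ^ Module.finrank ℝ E * |deriv (⇑timeBump) ((s - t) / ρ ^ 2) * (1 / ρ ^ 2) * (spaceCut ρ (x - y) * heatKernel (ν * (4 * r ^ 2 + t - s)) (x - y)) + ν * timeBump ((s - t) / ρ ^ 2) * (heatKernel (ν * (4 * r ^ 2 + t - s)) (x - y) * (Δ (spaceCut (E := E) ρ)) (x - y) + 2 * (∑ i, fderiv ℝ (spaceCut (E := E) ρ) (x - y) (b i) * fderiv ℝ (heatKernel (ν * (4 * r ^ 2 + t - s))) (x - y) (b i)))|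
      ≤ r ^ Module.finrank ℝ E * (|deriv (⇑timeBump) ((s - t) / ρ ^ 2)| * heatKernel (ν * (4 * r ^ 2 + t - s)) (x - y) * (1 / ρ ^ 2) + ν * (heatKernel (ν * (4 * r ^ 2 + t - s)) (x - y) * |(Δ (spaceCut (E := E) ρ)) (x - y)| + 2 * |(∑ i, fderiv ℝ (spaceCut (E := E) ρ) (x - y) (b i) * fderiv ℝ (heatKernel (ν * (4 * r ^ 2 + t - s))) (x - y) (b i))|)) :=
        mul_le_mul_of_nonneg_left htri (by positivity)
    _ ≤ r ^ Module.finrank ℝ E * (Mt * ((π * ν) ^ (-(Module.finrank ℝ E : ℝ) / 2) * (ρ ^ Module.finrank ℝ E)⁻¹) * (1 / ρ ^ 2) +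
          ν * (2 ^ Module.finrank ℝ E * C₀ * (ρ ^ Module.finrank ℝ E)⁻¹ * (M₂ / ρ ^ 2) +
            2 * (M₁ / ρ * (2 ^ (Module.finrank ℝ E + 1) * C₁ * (ρ ^ (Module.finrank ℝ E + 1))⁻¹)))) := by
        gcongr
    _ = (Mt * (π * ν) ^ (-(Module.finrank ℝ E : ℝ) / 2) +
          ν * (2 ^ Module.finrank ℝ E * C₀ * M₂ + 2 * (M₁ * (2 ^ (Module.finrank ℝ E + 1) * C₁)))) * r ^ Module.finrank ℝ E / ρ ^ (Module.finrank ℝ E + 2) := by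
        field_simp
        ring

/-! ### Assembly -/

/-- **Scheffer's test function: all properties with one constant** (Lemarié-Rieusset 2016,
§13.9, Step 1, p. 467, the bulleted list "`ψ` enjoys many good properties"; Scheffer 1977). Let
`ν > 0` and `n = dim E`. There is `C = C(ν, n) > 0` such that for all `(t, x) ∈ ℝ × E` and
`0 < r ≤ ρ/2`, the function `ψ = testFn ν r ρ t x`,
`ψ(s, y) = rⁿ χ((s-t)/ρ²) θ((s-t)/r²) φ((x-y)/ρ) W_{ν(4r²+t-s)}(x - y)`, satisfies:
* `ψ ∈ C_c^∞` with `tsupport ψ ⊆ Q_ρ(t, x) = (t - ρ², t + ρ²) × B(x, ρ)` ("`ψ` is smooth,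
  non-negative and is supported in `Q_ρ(t, x)`"), indeed `ψ(s, y) ≠ 0` forces `|s - t| < ρ²/2`
  and `‖y - x‖ < 5ρ/8 < 3ρ/4` (support in `(t - ρ², t + ρ²) × B(x, 3ρ/4)`, as used for the pressure
  term on p. 467);
* `0 ≤ ψ ≤ C` everywhere and `ψ ≥ C⁻¹` on `Q_r(t, x)` ("`ψ ≤ C` on `Q_ρ(t, x)`, and `ψ ≥ 1/C` on
  `Q_r(t, x)`");
* `‖∇_y ψ(s, y)‖ ≤ C/r` everywhere ("`|∇ψ| ≤ C r⁻¹` on `Q_ρ(t, x)`");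
* `|∂_s ψ(s, y) + ν Δ_y ψ(s, y)| ≤ C rⁿ/ρⁿ⁺²` for all `s < t + r²` and all `y` ("for
  `(s, y) ∈ Q_ρ(t, x)` with `s < t + r²`, `|(∂_s + νΔ_y)ψ| ≤ C r³/ρ⁵`", `n = 3`),
with `∂_s` the accepted `Fluid.timeDeriv` and `Δ_y` Mathlib's Laplacian of the slice `ψ(s, ·)`,
exactly the operators of the local energy inequality in `Fluid.IsSuitableWeakSolutionOn` /
`LemarieRieusset2016.IsSuitableOn`. [cite: LemarieRieusset2016, §13.9 Step 1 p. 467] -/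
theorem testFn_spec {ν : ℝ} (hν : 0 < ν) :
    ∃ C : ℝ, 0 < C ∧ ∀ (t : ℝ) (x : E) (r ρ : ℝ), 0 < r → r ≤ ρ / 2 →
      IsSpaceTimeTestOn (parabolicCylinderCenteredOpens ρ (t, x)) (testFn ν r ρ t x) ∧
      (∀ s y, 0 ≤ testFn ν r ρ t x s y) ∧
      (∀ s y, testFn ν r ρ t x s y ≤ C) ∧
      (∀ s y, testFn ν r ρ t x s y ≠ 0 → |s - t| < ρ ^ 2 / 2 ∧ ‖y - x‖ < 5 * ρ / 8) ∧
      (∀ s y, (s, y) ∈ parabolicCylinderCentered r ((t, x) : ℝ × E) → C⁻¹ ≤ testFn ν r ρ t x s y) ∧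
      (∀ s y, ‖fderiv ℝ (testFn ν r ρ t x s) y‖ ≤ C / r) ∧
      (∀ s y, s < t + r ^ 2 →
        |timeDeriv (testFn ν r ρ t x) s y + ν * (Δ (testFn ν r ρ t x s)) y| ≤
          C * r ^ Module.finrank ℝ E / ρ ^ (Module.finrank ℝ E + 2)) := by
  obtain ⟨Cg, hCg0, hCg⟩ := exists_norm_fderiv_testFn_le (E := E) hν
  obtain ⟨Ch, hCh0, hCh⟩ := exists_abs_heat_testFn_le (E := E) hν
  set cup : ℝ := (8 * π * ν) ^ (-(Module.finrank ℝ E : ℝ) / 2) with hcup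
  set clow : ℝ := (20 * π * ν) ^ (-(Module.finrank ℝ E : ℝ) / 2) * Real.exp (-(1 / (12 * ν))) with hclow
  have hclow0 : 0 < clow := by positivity
  set C : ℝ := max (max cup clow⁻¹) (max Cg Ch) with hC
  have hC1 : clow⁻¹ ≤ C := (le_max_right _ _).trans (le_max_left _ _)
  have hC0 : 0 < C := lt_of_lt_of_le (inv_pos.2 hclow0) hC1
  have hC2 : cup ≤ C := (le_max_left _ _).trans (le_max_left _ _)
  have hC3 : Cg ≤ C := (le_max_left _ _).trans (le_max_right _ _)
  have hC4 : Ch ≤ C := (le_max_right _ _).trans (le_max_right _ _)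
  refine ⟨C, hC0, fun t x r ρ hr hrρ => ⟨isSpaceTimeTestOn_testFn hν hr hrρ x,
    fun s y => testFn_nonneg hν hr x s y, fun s y => (testFn_le hν hr x s y).trans hC2,
    fun s y h => abs_lt_and_norm_lt_of_testFn_ne_zero hr hrρ h,
    fun s y h => ?_, fun s y => (hCg t x r ρ hr hrρ s y).trans ?_, fun s y hs => ?_⟩⟩
  · calc C⁻¹ ≤ (clow⁻¹)⁻¹ := inv_anti₀ (inv_pos.2 hclow0) hC1
      _ = clow := inv_inv _
      _ ≤ testFn ν r ρ t x s y := le_testFn_of_mem hν hr hrρ h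
  · exact div_le_div_of_nonneg_right hC3 hr.le
  · have hρ : 0 < ρ := by linarith
    refine (hCh t x r ρ hr hrρ s y hs).trans ?_
    rw [mul_div_assoc, mul_div_assoc]
    exact mul_le_mul_of_nonneg_right hC4 (by positivity)

omit [FiniteDimensional ℝ E] in
/-- `‖∇f(y)‖ = ‖Df(y)‖`: the gradient is the Riesz representative of the Fréchet derivative
(Mathlib `gradient`, an isometry `toDual.symm`). [folklore] -/
theorem norm_gradient_eq_norm_fderiv [CompleteSpace E] (f : E → ℝ) (y : E) :
    ‖gradient f y‖ = ‖fderiv ℝ f y‖ := by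
  rw [gradient, LinearIsometryEquiv.norm_map]

/-- **The gradient bound in the form consumed by the local energy inequality**: with the constant
`C` of `testFn_spec`, `‖∇_y ψ(s, ·)(y)‖ ≤ C/r` for Mathlib's `gradient` (the field paired with
`u` in `IsSuitableOn.localEnergy`), together with the other clauses of `testFn_spec` unchanged. [cite: LemarieRieusset2016, §13.9 Step 1 p. 467] -/
theorem testFn_spec_gradient {ν : ℝ} (hν : 0 < ν) :
    ∃ C : ℝ, 0 < C ∧ ∀ (t : ℝ) (x : E) (r ρ : ℝ), 0 < r → r ≤ ρ / 2 →
      IsSpaceTimeTestOn (parabolicCylinderCenteredOpens ρ (t, x)) (testFn ν r ρ t x) ∧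
      (∀ s y, 0 ≤ testFn ν r ρ t x s y) ∧
      (∀ s y, testFn ν r ρ t x s y ≤ C) ∧
      (∀ s y, testFn ν r ρ t x s y ≠ 0 → |s - t| < ρ ^ 2 / 2 ∧ ‖y - x‖ < 5 * ρ / 8) ∧
      (∀ s y, (s, y) ∈ parabolicCylinderCentered r ((t, x) : ℝ × E) → C⁻¹ ≤ testFn ν r ρ t x s y) ∧
      (∀ s y, ‖gradient (testFn ν r ρ t x s) y‖ ≤ C / r) ∧
      (∀ s y, s < t + r ^ 2 →
        |timeDeriv (testFn ν r ρ t x) s y + ν * (Δ (testFn ν r ρ t x s)) y| ≤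
          C * r ^ Module.finrank ℝ E / ρ ^ (Module.finrank ℝ E + 2)) := by
  obtain ⟨C, hC0, hC⟩ := testFn_spec (E := E) hν
  refine ⟨C, hC0, fun t x r ρ hr hrρ => ?_⟩
  obtain ⟨h1, h2, h3, h4, h5, h6, h7⟩ := hC t x r ρ hr hrρ
  exact ⟨h1, h2, h3, h4, h5, fun s y => (norm_gradient_eq_norm_fderiv _ _).le.trans (h6 s y), h7⟩

end Scheffer

/-! ### The printed form in `ℝ × ℝ³` -/

namespace LemarieRieusset2016

/-- **Scheffer's test function, as used in Lemarié-Rieusset 2016, §13.9, Step 1 (p. 467)**, in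
physical space `ℝ³`: for `ν > 0` there is `C = C(ν) > 0` such that for every `(t, x) ∈ ℝ × ℝ³`
and `0 < r ≤ ρ/2` there is a space–time test function `ψ` on the cylinder
`Q_ρ(t, x) = (t - ρ², t + ρ²) × B(x, ρ)` ("`ψ(s, y) = r³ ω((s-t)/ρ², (y-x)/ρ) θ((s-t)/r²)
H(4r² + t - s, x - y)`, `H(t, x) = W_{νt}(x)`") with: `ψ` smooth, non-negative, supported in
`(t - ρ², t + ρ²) × B(x, 3ρ/4) ⊆ Q_ρ(t, x)`; `ψ ≤ C`, and `ψ ≥ 1/C` on `Q_r(t, x)`; `|∇ψ| ≤ C/r`;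
and `|(∂_s + νΔ_y)ψ(s, y)| ≤ C r³/ρ⁵` for `s < t + r²` (V. Scheffer, *Hausdorff measure and the
Navier–Stokes equations*, Comm. Math. Phys. 55 (1977), the choice of test function; here from
`Scheffer.testFn_spec` with `n = 3`). [cite: LemarieRieusset2016, §13.9 Step 1 p. 467] -/
theorem exists_scheffer_testFunction {ν : ℝ} (hν : 0 < ν) :
    ∃ C : ℝ, 0 < C ∧ ∀ (t : ℝ) (x : EuclideanSpace ℝ (Fin 3)) (r ρ : ℝ), 0 < r → r ≤ ρ / 2 →
      ∃ ψ : ℝ → EuclideanSpace ℝ (Fin 3) → ℝ,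
        IsSpaceTimeTestOn (parabolicCylinderCenteredOpens ρ (t, x)) ψ ∧
        (∀ s y, 0 ≤ ψ s y) ∧
        (∀ s y, ψ s y ≤ C) ∧
        (∀ s y, ψ s y ≠ 0 → |s - t| < ρ ^ 2 ∧ ‖y - x‖ < 3 * ρ / 4) ∧
        (∀ s y, (s, y) ∈ parabolicCylinderCentered r ((t, x) : ℝ × EuclideanSpace ℝ (Fin 3)) →
          C⁻¹ ≤ ψ s y) ∧
        (∀ s y, ‖fderiv ℝ (ψ s) y‖ ≤ C / r) ∧
        (∀ s y, s < t + r ^ 2 →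
          |timeDeriv ψ s y + ν * (Δ (ψ s)) y| ≤ C * r ^ 3 / ρ ^ 5) := by
  obtain ⟨C, hC0, hC⟩ := Scheffer.testFn_spec (E := EuclideanSpace ℝ (Fin 3)) hν
  refine ⟨C, hC0, fun t x r ρ hr hrρ => ?_⟩
  obtain ⟨h1, h2, h3, h4, h5, h6, h7⟩ := hC t x r ρ hr hrρ
  have hρ : 0 < ρ := by linarith
  refine ⟨Scheffer.testFn ν r ρ t x, h1, h2, h3, fun s y h => ?_, h5, h6, fun s y hs => ?_⟩
  · obtain ⟨ha, hb⟩ := h4 s y h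
    exact ⟨by nlinarith, by linarith⟩
  · simpa [finrank_euclideanSpace] using h7 s y hs

end LemarieRieusset2016

end Literature.Analysis.FluidPDE
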